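import Literature.Combinatorics.Optimization.NeighborlyObstructionBlockPsdLifts
import Literature.LinearAlgebra.Matrix.GeneralizedVandermonde
import Mathlib.RingTheory.MvPolynomial.Homogeneous
import Mathlib.Data.Finsupp.Multiset
import Mathlib.Data.Sym.Card
import HarnessLib

/-!
# The semidefinite extension degree of the cones of polynomial optimization (Averkov 2019, Thm. 2, Cor. 3–5, Cor. 14)

G. Averkov, *Optimal size of linear matrix inequalities in semidefinite approaches to polynomial
optimization*, SIAM J. Appl. Algebra Geom. **3** (2019) 128–151 = arXiv:1806.08656 [cite: Averkov2019]
(held: `paper:arxiv-1806.08656`; page locators `pNN` below are the pages of that text). Everything here is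
PROVED; no facts are asserted.

Averkov's `(S^k_+)^m`-lifts are the tree's `HasBlockPsdLift C k m` (`BlockPsdLiftFactorization.lean`), and
"`sxd(C) > k`" (Def. 1, p03: the semidefinite extension degree is the least `k` such that `C` has an
`(S^k_+)^m`-lift for some `m`) is typed as `∀ m, ¬ HasBlockPsdLift C k m` (for all block sizes `≤ k`, by
`HasBlockPsdLift.mono_size`). The multivariate polynomial cones live in `MvPolynomial (Fin n) ℝ`:

* `nonnegPolynomialCone n D X = P_{n,D}(X) = {f ∈ ℝ[x]_D : f ≥ 0 on X}` (§1.2, p03; Averkov writes the degree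
  bound as `2d`).
* **`not_hasBlockPsdLift_of_vanishingPattern` — Theorem 2 (Main theorem, p05)**: "Let `X ⊆ ℝⁿ` be a set with
  non-empty interior. Let `C ⊆ P_{n,2d}(X)` be a closed convex cone such that there exist finite subsets `S` of
  `X` of arbitrarily large cardinality with the following property: (∗) For every `k`-element subset `T` of
  `S`, some polynomial `f` in the cone `C` is equal to zero on `T` and is strictly positive on `S ∖ T`. Then
  `sxd(C) > k`." Typed for any `C ⊆ P_{n,D}(X)` closed under positive scaling (closedness and convexity are
  not used by the proof).
* **`not_hasBlockPsdLift_of_sq_mem` — Corollary 3 (p05)**: "Let `X ⊆ ℝⁿ` be a set with non-empty interior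
  and `C` be a closed convex cone satisfying `Σ_{n,2d} ⊆ C ⊆ P_{n,2d}(X)`. Then `sxd(C) ≥ binom(n+d, n)`."
  Typed with the hypothesis "`q² ∈ C` for every `q ∈ ℝ[x]_d`" (which is what `Σ_{n,2d} ⊆ C` is used for,
  p12) and the conclusion `¬ HasBlockPsdLift C k m` for all `k < binom(n+d, n)` and all `m`
  (`not_hasBlockPsdLift_of_subset_of_subset` is the sandwiched form `Σ ⊆ C ⊆ P_{n,2d}(X)`);
  `card_Idx : |{α : |α| ≤ d}| = binom(n+d, n)` ("`ℝ[x]_d` is a vector space of dimension `binom(n+d,n)`", p03).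
* `sosPolynomialCone n d = Σ_{n,2d} = {f ∈ ℝ[x]_{2d} : f is SOS}` (§1.2, p03, verbatim: a sum of squares of
  finitely many polynomials, no degree bound on the squares), `totalDegree_le_of_sum_sq` (the squares then have
  degree `≤ d` — top homogeneous components over `ℝ`), **`hasBlockPsdLift_sosPolynomialCone` — (1.1)/(1.3)**
  ("`Σ_{n,2d} = {v_{n,d}ᵀ A v_{n,d} : A ∈ S^k_+}` for `k = binom(n+d,n)`", the Gram map `SosCone.gramMap`; the psd
  square root `CFC.sqrt` gives `A = BᵀB`), and **Corollary 4 (p05)** "`sxd(Σ_{n,2d}) = sxc(Σ_{n,2d}) =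
  binom(n+d,n)`": `not_hasBlockPsdLift_sosPolynomialCone`, `isLeast_blockSize_hasBlockPsdLift_sosPolynomialCone`
  (`sxd`), `isLeast_size_hasPsdLift_sosPolynomialCone` (`sxc`, over the tree's one-block `HasPsdLift`).
* `truncatedQuadraticModule d₀ g dg = Σ_{n,2d₀} + g_1 Σ_{n,2d_1} + ⋯ + g_k Σ_{n,2d_k}` ((1.5), p04) and
  **Corollary 5 (p05)**: for `g_i ≠ 0` with `X = {g_1 ≥ 0, …, g_k ≥ 0}` of non-empty interior,
  "`sxd(C) = binom(n+d,n)`, `d = max{d_0, …, d_k}`" — `hasBlockPsdLift_truncatedQuadraticModule` (the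
  straightforward `k+1` LMIs, Lemma 31 = `hasBlockPsdLift_finsetSum`), `not_hasBlockPsdLift_truncatedQuadraticModule`,
  `isLeast_blockSize_hasBlockPsdLift_truncatedQuadraticModule`; with the tools `not_hasBlockPsdLift_of_mul_sq_mem`
  (the common mechanism of Cor. 3 and Cor. 5: `h q² ∈ C` for `q ∈ ℝ[x]_d`, `h > 0` on `X`) and
  `eq_zero_of_eval_eq_zero_of_interior_nonempty` (a polynomial vanishing on a set with non-empty interior is `0`).
* `momentCone n D X = M_{n,D}(X) = cl(cone{v_{n,D}(x) : x ∈ X})` (§2.1, p06), Lemma 32's inclusion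
  `P_{n,D}(X) ⊆ M_{n,D}(X)^*` (`dotProduct_coeffVec_nonneg_of_mem_momentCone`), pointedness of the moment cone
  (`abs_apply_le_of_mem_momentCone`: `|y_γ| ≤ ⟨y, q⟩`, `q = Σ_{|α|≤d} x^{2α}`), and **Corollary 14 (p06)**
  "`sxd(M_{n,2d}(X)) ≥ binom(n+d,n)` for every `X` with non-empty interior": `not_hasBlockPsdLift_momentCone`,
  `mem_lowerBounds_blockSize_hasBlockPsdLift_momentCone` — proved WITHOUT the cone duality (2.2), by running the
  zero pattern on the moment side (the base of `M` is `(binom(n+d,n)−1)`-neighborly with respect to the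
  normalized moment vectors of Kronecker points; the tree's `not_hasBlockPsdLift_of_isNeighborlyWrt`).

## The proof formalised (Averkov §4–§5, pp. 10–12) and where we deviate

Averkov identifies `ℝ[x]_D` with `ℝ^{binom(n+D,n)}` through the coefficient vector and writes evaluation as
the scalar product with the moment vector `v_{n,D}(x) = (x^α)_{|α| ≤ D}` (Remark 23, p10): here `Idx n D`
(exponent vectors of total degree `≤ D`), `momentVector`, `coeffVec`, `ofVec`, `eval_eq_dotProduct`. His proof
of Thm. 2 feeds the zero pattern `f_T(s) = ⟨f_T, v(s)⟩ = 0 ⇔ s ∈ T` into the Key Lemma 26 via the cone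
version (Thm. 19) of the Gouveia–Parrilo–Thomas factorization theorem. The tree's factorization theorem
(`HasBlockPsdLift.hasPsdPowerFactorization_slack`, packaged with Lemma 26 as
`not_hasBlockPsdLift_of_zeroPattern` in `NeighborlyObstructionBlockPsdLifts.lean`) is Slater-free but wants a
BOUNDED lifted set, so — exactly as in the univariate case `not_hasBlockPsdLift_nonnegPolyCoeff` there — we
pass to the compact base `C ∩ {f : Σ_{s ∈ S₀} f(s) = 1}` of the pointed cone `C` (Averkov p08: "if `C` is
pointed … `{x ∈ C : ⟨u, x⟩ = 1}` is a bounded affine slice"), `S₀ ⊆ X` a set of `binom(n+D,n)` points at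
which evaluation is a linear isomorphism of `ℝ[x]_D`; this is where "`X` has non-empty interior" enters.

For Cor. 3 Averkov needs point sets `S ⊆ X` of arbitrary size whose moment vectors `v_{n,d}(s)` are in
general linear position (Lemma 27, p12, by Zariski density of the non-vanishing of the `binom(N, k)` minors),
and Lemma 28 (a nonzero `f ∈ ℝ[x]_d` vanishes on any `binom(n+d,n) − 1` prescribed points, by a dimension
count — here `LinearMap.ker_ne_bot_of_finrank_lt`). DEVIATION (a shorter road through the tree): instead of
the density argument we take EXPLICIT points on a scaled Kronecker moment curve,
`kronPt w B t = (w_i t^{B^i})_i` with `B > D`, `w_i ≠ 0` and distinct parameters `t > 0`: the monomials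
`x^α`, `|α| ≤ D`, restrict to distinct powers `t^{Σ α_i B^i}` (base-`B` digits, `kronExp_injective`), so a
nonzero `f ∈ ℝ[x]_D` restricts to a nonzero real polynomial with at most `binom(n+D,n)` terms
(`fewnomial`), which has fewer than `binom(n+D,n)` positive roots by Descartes' rule of signs (the tree's
`GeneralizedVandermonde.countP_roots_pos_le`, Fischler–Sprang–Zudilin 2019 §5); hence ANY `binom(n+D,n)` such
points are unisolvent (`eq_zero_of_dotProduct_kronPt_eq_zero` = Lemma 27(b) for these points), and such
points exist inside any open set (`exists_kronPt_mem`, cf. Remark 30, p12, the case `d = 1`).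

Not here (successor work): Cor. 10–12 and 15 (Hilbert/Scheiderer cases), the cone duality (2.1)/(2.2)
itself, Cor. 16 (copositive cones: the lower bound is `CopositiveConeExtensionDegree.lean`), Prop. 7 / Thm. 17
(second-order cone programming, SONC, §6). The case `n = 1` of Cor. 4 (in coefficient
coordinates `Fin (2d+1) → ℝ`) and Cor. 6 (`sxd(S^k_+) = k`) are in `NeighborlyObstructionBlockPsdLifts.lean`.
-/

noncomputable section

open Finset Matrix MvPolynomial
open scoped MatrixOrder

universe u

namespace Literature.Combinatorics.Optimization

namespace SosCone

/-! ### Coefficient coordinates on `ℝ[x]_D` (Averkov Remark 23) -/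

/-- The exponent vectors `α ∈ ℤ_+^n` with `|α| = α_1 + ⋯ + α_n ≤ D`, as a finite type (coordinates of
`ℝ[x]_D ≅ ℝ^{binom(n+D,n)}`). [cite: Averkov2019, §1.2 (p03) and Remark 23 (p10)] -/
abbrev Idx (n D : ℕ) : Type := {β : Fin n → Fin (D + 1) // ∑ i, (β i : ℕ) ≤ D}

/-- The exponent vector as a finitely supported function (Mathlib's monomial exponents). [folklore] -/
def Idx.toFinsupp {n D : ℕ} (β : Idx n D) : Fin n →₀ ℕ :=
  Finsupp.equivFunOnFinite.symm fun i => (β.1 i : ℕ)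

/-- Components of the exponent vector. [folklore] -/
@[simp] private theorem Idx.toFinsupp_apply {n D : ℕ} (β : Idx n D) (i : Fin n) :
    β.toFinsupp i = (β.1 i : ℕ) := by
  simp [Idx.toFinsupp]

/-- Distinct exponent vectors give distinct monomials. [folklore] -/
private theorem Idx.toFinsupp_injective {n D : ℕ} : Function.Injective (Idx.toFinsupp : Idx n D → Fin n →₀ ℕ) := by
  intro β γ h
  apply Subtype.ext
  funext i
  apply Fin.ext
  have := DFunLike.congr_fun h i
  simpa using this

/-- The degree `|α|` of the exponent vector of `β` is `Σ_i β_i ≤ D`. [folklore] -/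
private theorem Idx.sum_toFinsupp {n D : ℕ} (β : Idx n D) :
    (β.toFinsupp.sum fun _ e => e) = ∑ i, (β.1 i : ℕ) := by
  rw [Finsupp.sum_fintype _ _ (fun _ => rfl)]
  simp

/-- `|α| ≤ D` for `α` the exponent vector of `β : Idx n D`. [folklore] -/
private theorem Idx.sum_toFinsupp_le {n D : ℕ} (β : Idx n D) : (β.toFinsupp.sum fun _ e => e) ≤ D := by
  rw [Idx.sum_toFinsupp]; exact β.2

/-- Every exponent vector of degree `≤ D` is represented in `Idx n D`. [folklore] -/
private theorem Idx.exists_toFinsupp_eq {n D : ℕ} {α : Fin n →₀ ℕ} (h : (α.sum fun _ e => e) ≤ D) :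
    ∃ β : Idx n D, β.toFinsupp = α := by
  have hsum : (α.sum fun _ e => e) = ∑ i, α i := by
    rw [Finsupp.sum_fintype _ _ (fun _ => rfl)]
  have hi : ∀ i, α i ≤ D := fun i =>
    le_trans (by rw [hsum]; exact single_le_sum (f := fun j => α j) (fun j _ => Nat.zero_le _) (mem_univ i)) h
  refine ⟨⟨fun i => ⟨α i, Nat.lt_succ_of_le (hi i)⟩, by rw [hsum] at h; simpa using h⟩, ?_⟩
  ext i
  simp

/-- **The moment vector `v_{n,D}(x) = (x^α)_{|α| ≤ D}`** ("the vector of all monomials of degree at most `d` in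
`n` variables"). [cite: Averkov2019, (1.2) (p03) and Remark 23 (p10)] -/
def momentVector {n : ℕ} (D : ℕ) (x : Fin n → ℝ) : Idx n D → ℝ := fun β => ∏ i, x i ^ (β.1 i : ℕ)

/-- The coefficient vector `(f_α)_{|α| ≤ D}` of a polynomial (the identification `ℝ[x]_D ≅ ℝ^{binom(n+D,n)}`,
extended to all of `ℝ[x]` by forgetting higher coefficients). [cite: Averkov2019, Remark 23 (p10)] -/
def coeffVec (n D : ℕ) : MvPolynomial (Fin n) ℝ →ₗ[ℝ] (Idx n D → ℝ) where
  toFun p β := p.coeff β.toFinsupp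
  map_add' p q := by funext β; simp
  map_smul' a p := by funext β; simp

/-- The `α`-th coordinate of the coefficient vector is the coefficient `f_α`.
[cite: Averkov2019, Remark 23 (p10)] -/
@[simp] theorem coeffVec_apply {n D : ℕ} (p : MvPolynomial (Fin n) ℝ) (β : Idx n D) :
    coeffVec n D p β = p.coeff β.toFinsupp := rfl

/-- The polynomial `Σ_α c_α x^α ∈ ℝ[x]_D` with coefficient vector `c` (inverse identification).
[cite: Averkov2019, Remark 23 (p10)] -/
def ofVec (n D : ℕ) : (Idx n D → ℝ) →ₗ[ℝ] MvPolynomial (Fin n) ℝ where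
  toFun c := ∑ β, monomial β.toFinsupp (c β)
  map_add' c c' := by simp only [Pi.add_apply, map_add, sum_add_distrib]
  map_smul' a c := by
    simp only [Pi.smul_apply, smul_eq_mul, RingHom.id_apply, Finset.smul_sum, smul_monomial]

/-- `ofVec c = Σ_α c_α x^α`. [cite: Averkov2019, Remark 23 (p10)] -/
theorem ofVec_apply {n D : ℕ} (c : Idx n D → ℝ) : ofVec n D c = ∑ β, monomial β.toFinsupp (c β) := rfl

/-- `coeffVec ∘ ofVec = id`: the identification `ℝ[x]_D ≅ ℝ^{binom(n+D,n)}` is inverse to `ofVec`.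
[cite: Averkov2019, Remark 23 (p10)] -/
@[simp] theorem coeffVec_ofVec {n D : ℕ} (c : Idx n D → ℝ) : coeffVec n D (ofVec n D c) = c := by
  classical
  funext β
  simp only [coeffVec_apply, ofVec_apply, coeff_sum, coeff_monomial]
  rw [Finset.sum_eq_single β]
  · simp
  · intro γ _ hγ
    rw [if_neg fun h => hγ (Idx.toFinsupp_injective h)]
  · simp

/-- `ofVec ∘ coeffVec = id` on `ℝ[x]_D` (the identification is a bijection on polynomials of degree `≤ D`).
[cite: Averkov2019, Remark 23 (p10)] -/
theorem ofVec_coeffVec {n D : ℕ} {p : MvPolynomial (Fin n) ℝ} (hp : p.totalDegree ≤ D) :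
    ofVec n D (coeffVec n D p) = p := by
  classical
  ext α
  simp only [ofVec_apply, coeffVec_apply, coeff_sum, coeff_monomial]
  by_cases hα : (α.sum fun _ e => e) ≤ D
  · obtain ⟨β₀, hβ₀⟩ := Idx.exists_toFinsupp_eq hα
    rw [Finset.sum_eq_single β₀]
    · rw [if_pos hβ₀, hβ₀]
    · intro γ _ hγ
      rw [if_neg fun h => hγ (Idx.toFinsupp_injective (h.trans hβ₀.symm))]
    · simp
  · have hcoeff : p.coeff α = 0 := by
      by_contra hne
      exact hα ((le_totalDegree (mem_support_iff.2 hne)).trans hp)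
    rw [hcoeff]
    refine Finset.sum_eq_zero fun γ _ => ?_
    rw [if_neg]
    intro h
    exact hα (h ▸ Idx.sum_toFinsupp_le γ)

/-- `ofVec c ∈ ℝ[x]_D` (total degree `≤ D`). [cite: Averkov2019, Remark 23 (p10)] -/
theorem totalDegree_ofVec_le {n D : ℕ} (c : Idx n D → ℝ) : (ofVec n D c).totalDegree ≤ D :=
  totalDegree_finsetSum_le fun β _ => (totalDegree_monomial_le _ _).trans (Idx.sum_toFinsupp_le β)

/-- `ofVec c = 0 ↔ c = 0` (the identification is linear and injective). [cite: Averkov2019, Remark 23 (p10)] -/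
theorem ofVec_eq_zero_iff {n D : ℕ} (c : Idx n D → ℝ) : ofVec n D c = 0 ↔ c = 0 := by
  constructor
  · intro h
    have := coeffVec_ofVec c
    rwa [h, map_zero, eq_comm] at this
  · rintro rfl; exact map_zero _

/-- **Evaluation is the scalar product with the moment vector**, `f(x) = ⟨f, v_{n,D}(x)⟩` on `ℝ[x]_D` — for
the polynomial with coefficient vector `c`. [cite: Averkov2019, Remark 23 (p10)] -/
theorem eval_ofVec {n D : ℕ} (c : Idx n D → ℝ) (x : Fin n → ℝ) :
    eval x (ofVec n D c) = momentVector D x ⬝ᵥ c := by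
  simp only [ofVec_apply, map_sum, eval_monomial, dotProduct, momentVector]
  refine sum_congr rfl fun β _ => ?_
  rw [Finsupp.prod_fintype _ _ (fun _ => pow_zero _), mul_comm]
  simp

/-- **Evaluation is the scalar product with the moment vector**, `f(x) = ⟨f, v_{n,D}(x)⟩` for `f ∈ ℝ[x]_D`.
[cite: Averkov2019, Remark 23 (p10)] -/
theorem eval_eq_dotProduct {n D : ℕ} {p : MvPolynomial (Fin n) ℝ} (hp : p.totalDegree ≤ D) (x : Fin n → ℝ) :
    eval x p = momentVector D x ⬝ᵥ coeffVec n D p := by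
  conv_lhs => rw [← ofVec_coeffVec hp]
  exact eval_ofVec _ _

/-- **`dim ℝ[x]_d = binom(n+d, n)`**: the number of exponent vectors of degree `≤ d` in `n` variables (stars and
bars: `{α ∈ ℤ_+^n : |α| ≤ d} ≃ {α' ∈ ℤ_+^{n+1} : |α'| = d} ≃ Sym (Fin (n+1)) d`).
[cite: Averkov2019, §1.2 (p03, "`ℝ[x]_d` … is a vector space of dimension `binom(n+d,n)`")] -/
theorem card_Idx (n d : ℕ) : Fintype.card (Idx n d) = (n + d).choose n := by
  classical
  let e : Idx n d ≃ {P : Fin (n + 1) → ℕ // ∑ i, P i = d} :=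
    { toFun := fun β => ⟨Fin.cons (d - ∑ i, (β.1 i : ℕ)) (fun i => (β.1 i : ℕ)), by
          have := β.2
          rw [Fin.sum_univ_succ, Fin.cons_zero]
          simp only [Fin.cons_succ]
          omega⟩
      invFun := fun P => ⟨fun i => ⟨P.1 i.succ, by
          have h1 : P.1 i.succ ≤ ∑ j, P.1 j := single_le_sum (f := fun j => P.1 j) (fun j _ => Nat.zero_le _)
            (mem_univ _)
          rw [P.2] at h1
          omega⟩, by
          have h := P.2
          rw [Fin.sum_univ_succ] at h
          simp only
          omega⟩
      left_inv := fun β => by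
        apply Subtype.ext
        funext i
        apply Fin.ext
        simp only [Fin.cons_succ]
      right_inv := fun P => by
        apply Subtype.ext
        funext i
        refine Fin.cases ?_ (fun j => ?_) i
        · have h := P.2
          rw [Fin.sum_univ_succ] at h
          simp only [Fin.cons_zero]
          omega
        · simp only [Fin.cons_succ] }
  rw [Fintype.card_congr (e.trans (Sym.equivNatSumOfFintype (Fin (n + 1)) d).symm),
    Sym.card_sym_eq_choose, Fintype.card_fin, show n + 1 + d - 1 = n + d by omega]
  exact (Nat.choose_symm_add (a := n) (b := d)).symm

/-! ### Lemma 27 by an explicit construction: Kronecker points and Descartes' rule of signs -/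

/-- Base-`B` digit expansions are injective: `Σ_i f_i B^i = Σ_i g_i B^i` with all digits `< B` forces
`f = g`. [folklore] -/
private theorem digits_injective (B : ℕ) : ∀ (n : ℕ) (f g : Fin n → ℕ), (∀ i, f i < B) → (∀ i, g i < B) →
    ∑ i, f i * B ^ (i : ℕ) = ∑ i, g i * B ^ (i : ℕ) → f = g
  | 0, f, g, _, _, _ => funext fun i => i.elim0
  | n + 1, f, g, hf, hg, h => by
    have key : ∀ u : Fin (n + 1) → ℕ,
        ∑ i, u i * B ^ (i : ℕ) = u 0 + B * ∑ i : Fin n, u i.succ * B ^ (i : ℕ) := by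
      intro u
      rw [Fin.sum_univ_succ, Fin.val_zero, pow_zero, mul_one, Finset.mul_sum]
      congr 1
      refine sum_congr rfl fun i _ => ?_
      rw [Fin.val_succ, pow_succ]
      ring
    rw [key f, key g] at h
    have hB : 0 < B := lt_of_le_of_lt (Nat.zero_le _) (hf 0)
    have h0 : f 0 = g 0 := by
      have := congrArg (· % B) h
      simpa only [Nat.add_mul_mod_self_left, Nat.mod_eq_of_lt (hf 0), Nat.mod_eq_of_lt (hg 0)] using this
    have h1 : ∑ i : Fin n, f i.succ * B ^ (i : ℕ) = ∑ i : Fin n, g i.succ * B ^ (i : ℕ) := by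
      have := congrArg (· / B) h
      simpa only [Nat.add_mul_div_left _ _ hB, Nat.div_eq_of_lt (hf 0), Nat.div_eq_of_lt (hg 0),
        zero_add] using this
    have htail := digits_injective B n (fun i => f i.succ) (fun i => g i.succ) (fun i => hf _) (fun i => hg _) h1
    funext i
    refine Fin.cases h0 (fun j => ?_) i
    exact congrFun htail j

/-- The Kronecker exponent `Σ_i α_i B^i` of an exponent vector. [folklore] -/
def kronExp {n D : ℕ} (B : ℕ) (β : Idx n D) : ℕ := ∑ i, (β.1 i : ℕ) * B ^ (i : ℕ)

/-- For `B > D` the Kronecker exponents of distinct `α`, `|α| ≤ D`, are distinct (the `α_i ≤ D < B` are the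
base-`B` digits). [folklore] -/
private theorem kronExp_injective {n D B : ℕ} (hB : D < B) : Function.Injective (kronExp B : Idx n D → ℕ) := by
  intro β γ h
  have := digits_injective B n (fun i => (β.1 i : ℕ)) (fun i => (γ.1 i : ℕ))
    (fun i => lt_of_le_of_lt (Nat.le_of_lt_succ (β.1 i).2) hB)
    (fun i => lt_of_le_of_lt (Nat.le_of_lt_succ (γ.1 i).2) hB) h
  exact Subtype.ext (funext fun i => Fin.ext (congrFun this i))

/-- The point `(w_i t^{B^i})_{i<n}` of the scaled Kronecker moment curve. [folklore] -/
def kronPt {n : ℕ} (w : Fin n → ℝ) (B : ℕ) (t : ℝ) : Fin n → ℝ := fun i => w i * t ^ (B ^ (i : ℕ))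

/-- Monomials restrict to the Kronecker curve as monomials in `t`:
`(kronPt w B t)^α = w^α t^{Σ α_i B^i}`. [folklore] -/
private theorem momentVector_kronPt {n D : ℕ} (w : Fin n → ℝ) (B : ℕ) (t : ℝ) (β : Idx n D) :
    momentVector D (kronPt w B t) β = (∏ i, w i ^ (β.1 i : ℕ)) * t ^ kronExp B β := by
  simp only [momentVector, kronPt, mul_pow, Finset.prod_mul_distrib]
  congr 1
  rw [kronExp, ← Finset.prod_pow_eq_pow_sum]
  exact Finset.prod_congr rfl fun i _ => by rw [← pow_mul, mul_comm]

/-- The restriction `t ↦ f(kronPt w B t)` of the polynomial with coefficient vector `c`, as a univariate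
polynomial with at most `binom(n+D,n)` terms. [folklore] -/
def fewnomial {n D : ℕ} (w : Fin n → ℝ) (B : ℕ) (c : Idx n D → ℝ) : Polynomial ℝ :=
  ∑ β, Polynomial.C (c β * ∏ i, w i ^ (β.1 i : ℕ)) * Polynomial.X ^ kronExp B β

/-- `fewnomial` is the restriction to the curve. [folklore] -/
private theorem eval_fewnomial {n D : ℕ} (w : Fin n → ℝ) (B : ℕ) (c : Idx n D → ℝ) (t : ℝ) :
    (fewnomial w B c).eval t = momentVector D (kronPt w B t) ⬝ᵥ c := by
  simp only [fewnomial, Polynomial.eval_finsetSum, Polynomial.eval_mul, Polynomial.eval_C,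
    Polynomial.eval_pow, Polynomial.eval_X, dotProduct, momentVector_kronPt]
  exact Finset.sum_congr rfl fun β _ => by ring

/-- The coefficients of `fewnomial` (for `B > D` the exponents do not collide). [folklore] -/
private theorem coeff_fewnomial {n D B : ℕ} (hB : D < B) (w : Fin n → ℝ) (c : Idx n D → ℝ) (β : Idx n D) :
    (fewnomial w B c).coeff (kronExp B β) = c β * ∏ i, w i ^ (β.1 i : ℕ) := by
  simp only [fewnomial, Polynomial.finsetSum_coeff, Polynomial.coeff_C_mul_X_pow]
  rw [Finset.sum_eq_single β]
  · simp
  · intro γ _ hγ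
    rw [if_neg fun h => hγ (kronExp_injective hB h).symm]
  · simp

/-- For nonzero weights and `c ≠ 0` the restriction to the curve is a nonzero polynomial. [folklore] -/
private theorem fewnomial_ne_zero {n D B : ℕ} (hB : D < B) {w : Fin n → ℝ} (hw : ∀ i, w i ≠ 0) {c : Idx n D → ℝ}
    (hc : c ≠ 0) : fewnomial w B c ≠ 0 := by
  obtain ⟨β, hβ⟩ := Function.ne_iff.1 hc
  intro h
  have h1 := coeff_fewnomial hB w c β
  rw [h, Polynomial.coeff_zero] at h1
  have h2 : (∏ i, w i ^ (β.1 i : ℕ)) ≠ 0 := Finset.prod_ne_zero_iff.2 fun i _ => pow_ne_zero _ (hw i)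
  exact mul_ne_zero hβ h2 h1.symm

/-- Descartes' bound for the restriction: at most `binom(n+D,n) − 1` positive roots (the tree's
`GeneralizedVandermonde.countP_roots_pos_le`, Fischler–Sprang–Zudilin 2019 §5, claim).
[cite: FischlerSprangZudilin2019, §5, analytical proof of Lemma 4 (claim)] -/
theorem countP_roots_fewnomial_le {n D : ℕ} (w : Fin n → ℝ) (B : ℕ) (c : Idx n D → ℝ) :
    (fewnomial w B c).roots.countP (0 < ·) ≤ Fintype.card (Idx n D) - 1 := by
  classical
  let e := Fintype.equivFin (Idx n D)
  have h : fewnomial w B c = ∑ i : Fin (Fintype.card (Idx n D)),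
      Polynomial.C ((fun i => c (e.symm i) * ∏ l, w l ^ ((e.symm i).1 l : ℕ)) i) *
        Polynomial.X ^ ((fun i => kronExp B (e.symm i)) i) := by
    rw [fewnomial]
    exact Fintype.sum_equiv e _ _ fun β => by simp [e]
  rw [h]
  exact Literature.LinearAlgebra.Matrix.GeneralizedVandermonde.countP_roots_pos_le _ _

/-- **Lemma 27(b) for Kronecker points (unisolvence).** For `B > D`, nonzero weights and distinct positive
parameters `t_j`, a coefficient vector `c ∈ ℝ^{binom(n+D,n)}` with `⟨v_{n,D}(kronPt w B t_j), c⟩ = 0` for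
`binom(n+D,n)` indices `j` vanishes: "every non-zero polynomial `f ∈ ℝ[x]_d` is equal to zero on at most
`binom(n+d,n) − 1` points" of such a point set. [cite: Averkov2019, Lemma 27 (p12)] -/
theorem eq_zero_of_dotProduct_kronPt_eq_zero {n D B : ℕ} (hB : D < B) {w : Fin n → ℝ} (hw : ∀ i, w i ≠ 0)
    {t : ℕ → ℝ} (ht0 : ∀ j, 0 < t j) (ht : Function.Injective t) {c : Idx n D → ℝ} (J : Finset ℕ)
    (hJ : Fintype.card (Idx n D) ≤ J.card) (hc : ∀ j ∈ J, momentVector D (kronPt w B (t j)) ⬝ᵥ c = 0) :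
    c = 0 := by
  classical
  by_contra hne
  have hF := fewnomial_ne_zero hB hw hne
  have h1 : J.card ≤ (fewnomial w B c).roots.countP (0 < ·) := by
    rw [← Finset.card_image_of_injective J ht]
    have hle : (J.image t).val ≤ (fewnomial w B c).roots := by
      rw [Multiset.le_iff_subset (J.image t).nodup]
      intro s hs
      obtain ⟨j, hj, rfl⟩ := Finset.mem_image.1 hs
      exact (Polynomial.mem_roots hF).2 (by rw [Polynomial.IsRoot, eval_fewnomial, hc j hj])
    have hS : (J.image t).val.countP (0 < ·) = (J.image t).card := by
      rw [Finset.card_def]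
      exact Multiset.countP_eq_card.2 fun s hs => by
        obtain ⟨j, -, rfl⟩ := Finset.mem_image.1 hs
        exact ht0 j
    rw [← hS]
    exact Multiset.countP_le_of_le _ hle
  have h2 := countP_roots_fewnomial_le w B c
  have hN : 0 < Fintype.card (Idx n D) := Fintype.card_pos_iff.2 ⟨⟨fun _ => 0, by simp⟩⟩
  omega

/-- **Generic points inside `X`** (Lemma 27(a) made explicit, cf. Remark 30): a set with non-empty interior
contains a whole sequence of Kronecker points `kronPt w B t_j` with nonzero weights and distinct positive
parameters. [cite: Averkov2019, Lemma 27 (p12), Remark 30 (p12)] -/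
theorem exists_kronPt_mem {n : ℕ} {X : Set (Fin n → ℝ)} (hX : (interior X).Nonempty) (B : ℕ) :
    ∃ (w : Fin n → ℝ) (t : ℕ → ℝ), (∀ i, w i ≠ 0) ∧ (∀ j, 0 < t j) ∧ Function.Injective t ∧
      ∀ j, kronPt w B (t j) ∈ X := by
  obtain ⟨x₀, hx₀⟩ := hX
  rw [mem_interior_iff_mem_nhds, Metric.mem_nhds_iff] at hx₀
  obtain ⟨ε, hε, hball⟩ := hx₀
  let w : Fin n → ℝ := fun i => if x₀ i = 0 then ε / 2 else x₀ i
  have hw0 : ∀ i, w i ≠ 0 := fun i => by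
    by_cases h : x₀ i = 0
    · simp only [w, if_pos h]; exact (half_pos hε).ne'
    · simp only [w, if_neg h]; exact h
  have hwx : dist w x₀ ≤ ε / 2 := by
    refine (dist_pi_le_iff (half_pos hε).le).2 fun i => ?_
    by_cases h : x₀ i = 0
    · simp only [w, if_pos h, Real.dist_eq, h, sub_zero, abs_of_pos (half_pos hε)]; exact le_rfl
    · simp only [w, if_neg h, dist_self]; exact (half_pos hε).le
  have hcont : Continuous fun s : ℝ => kronPt w B s :=
    continuous_pi fun i => continuous_const.mul (continuous_pow _)
  have h1 : kronPt w B 1 = w := funext fun i => by simp [kronPt]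
  obtain ⟨δ, hδ, hδε⟩ := Metric.continuous_iff.1 hcont 1 (ε / 2) (half_pos hε)
  refine ⟨w, fun j => 1 + δ / ((j : ℝ) + 2), hw0, fun j => by positivity, ?_, fun j => hball ?_⟩
  · intro j j' h
    have h' : δ / ((j : ℝ) + 2) = δ / ((j' : ℝ) + 2) := by linarith
    rw [div_eq_div_iff (by positivity) (by positivity)] at h'
    have h'' := mul_left_cancel₀ hδ.ne' h'
    exact_mod_cast (by linarith : (j : ℝ) = j')
  · rw [Metric.mem_ball]
    have hd : dist (1 + δ / ((j : ℝ) + 2)) 1 < δ := by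
      rw [Real.dist_eq, add_sub_cancel_left, abs_of_pos (by positivity)]
      exact div_lt_self hδ (by linarith)
    calc dist (kronPt w B (1 + δ / ((j : ℝ) + 2))) x₀
        ≤ dist (kronPt w B (1 + δ / ((j : ℝ) + 2))) (kronPt w B 1) + dist (kronPt w B 1) x₀ :=
          dist_triangle _ _ _
      _ < ε / 2 + ε / 2 := add_lt_add_of_lt_of_le (hδε _ hd) (by rw [h1]; exact hwx)
      _ = ε := by ring

end SosCone

open SosCone

/-! ### The cone `P_{n,D}(X)` and Theorem 2 -/

/-- **`P_{n,D}(X) = {f ∈ ℝ[x]_D : f ≥ 0 on X}`**, the cone of `n`-variate real polynomials of total degree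
`≤ D` nonnegative on `X ⊆ ℝⁿ` (Averkov writes the degree bound as `2d`; `P_{n,2d} = P_{n,2d}(ℝⁿ)`).
[cite: Averkov2019, §1.2 (p03)] -/
def nonnegPolynomialCone (n D : ℕ) (X : Set (Fin n → ℝ)) : Set (MvPolynomial (Fin n) ℝ) :=
  {p | p.totalDegree ≤ D ∧ ∀ x ∈ X, 0 ≤ eval x p}

/-- Membership in `P_{n,D}(X)`. [cite: Averkov2019, §1.2 (p03)] -/
theorem mem_nonnegPolynomialCone_iff {n D : ℕ} {X : Set (Fin n → ℝ)} {p : MvPolynomial (Fin n) ℝ} :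
    p ∈ nonnegPolynomialCone n D X ↔ p.totalDegree ≤ D ∧ ∀ x ∈ X, 0 ≤ eval x p := Iff.rfl

/-- **Averkov 2019, Theorem 2 (Main theorem).** "Let `X ⊆ ℝⁿ` be a set with non-empty interior. Let
`C ⊆ P_{n,2d}(X)` be a closed convex cone such that there exist finite subsets `S` of `X` of arbitrarily large
cardinality with the following property: (∗) For every `k`-element subset `T` of `S`, some polynomial `f` in
the cone `C` is equal to zero on `T` and is strictly positive on `S ∖ T`. Then `sxd(C) > k`", i.e. `C` has
no `(S^k_+)^m`-lift for any `m` (and none with smaller blocks, `HasBlockPsdLift.mono_size`). Typed for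
`C ⊆ P_{n,D}(X)` closed under multiplication by positive scalars; "closed" and "convex" are not used. Proof
(§4, p10–p11): on the bounded base `{f ∈ C : Σ_{s∈S₀} f(s) = 1}` (`S₀ ⊆ X` unisolvent Kronecker points,
`exists_kronPt_mem`, `eq_zero_of_dotProduct_kronPt_eq_zero`) the normalized `f_T` and the evaluations
`f ↦ −f(s) ≤ 0`, `s ∈ S`, have the zero pattern `f_T(s) = 0 ⇔ s ∈ T`, and
`not_hasBlockPsdLift_of_zeroPattern` (Key Lemma 26 + the factorization theorem) applies.
[cite: Averkov2019, Thm. 2 (p05), proof §4 (p10–p11)] -/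
theorem not_hasBlockPsdLift_of_vanishingPattern {n D k m : ℕ} {X : Set (Fin n → ℝ)}
    (hX : (interior X).Nonempty) {C : Set (MvPolynomial (Fin n) ℝ)}
    (hcone : ∀ p ∈ C, ∀ r : ℝ, 0 < r → r • p ∈ C) (hCX : C ⊆ nonnegPolynomialCone n D X)
    (hS : ∀ N : ℕ, ∃ S : Finset (Fin n → ℝ), N ≤ S.card ∧ (↑S : Set (Fin n → ℝ)) ⊆ X ∧
      ∀ T ∈ S.powersetCard k, ∃ f ∈ C, (∀ x ∈ T, eval x f = 0) ∧ ∀ x ∈ S, x ∉ T → 0 < eval x f) :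
    ¬ HasBlockPsdLift C k m := by
  classical
  intro hlift
  -- a nonzero element of `C`, from (∗) with `|S| ≥ k + 1`
  have hex : ∃ f ∈ C, f ≠ 0 := by
    obtain ⟨S, hcard, -, hpat⟩ := hS (k + 1)
    obtain ⟨T, hTS, hTk⟩ := Finset.exists_subset_card_eq (show k ≤ S.card by omega)
    have hT : T ∈ S.powersetCard k := mem_powersetCard.2 ⟨hTS, hTk⟩
    obtain ⟨s, hsS, hsT⟩ : ∃ s ∈ S, s ∉ T := by
      by_contra h
      push Not at h
      have := card_le_card (show S ⊆ T from h)
      omega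
    obtain ⟨f, hfC, -, hpos⟩ := hpat T hT
    exact ⟨f, hfC, fun h0 => (hpos s hsS hsT).ne' (by rw [h0, map_zero])⟩
  -- degenerate block sizes: an `(S^0_+)^m`- or `(S^k_+)^0`-lift lifts only `{0}`
  rcases Nat.eq_zero_or_pos k with hk | hk
  · obtain ⟨f, hfC, hf0⟩ := hex
    exact hf0 (Set.mem_singleton_iff.1 (hlift.subset_zero_of_eq_zero (Or.inl hk) hfC))
  rcases Nat.eq_zero_or_pos m with hm | hm
  · obtain ⟨f, hfC, hf0⟩ := hex
    exact hf0 (Set.mem_singleton_iff.1 (hlift.subset_zero_of_eq_zero (Or.inr hm) hfC))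
  -- unisolvent Kronecker points `pt 0, …, pt (N₀ - 1)` in `X`
  obtain ⟨w, t, hw, ht0, ht, hmem⟩ := exists_kronPt_mem hX (D + 1)
  set N₀ := Fintype.card (Idx n D) with hN₀
  let pt : ℕ → (Fin n → ℝ) := fun j => kronPt w (D + 1) (t j)
  let ev₀ : (Idx n D → ℝ) →ₗ[ℝ] (Fin N₀ → ℝ) :=
    { toFun := fun c j => momentVector D (pt j) ⬝ᵥ c
      map_add' := fun c c' => funext fun j => dotProduct_add _ _ _
      map_smul' := fun a c => funext fun j => by
        simp only [dotProduct_smul, smul_eq_mul, RingHom.id_apply, Pi.smul_apply] }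
  have hev₀_apply : ∀ c j, ev₀ c j = momentVector D (pt j) ⬝ᵥ c := fun c j => rfl
  have hev₀ : Function.Injective ev₀ := by
    intro c c' h
    rw [← sub_eq_zero]
    refine eq_zero_of_dotProduct_kronPt_eq_zero (Nat.lt_succ_self D) hw ht0 ht (Finset.range N₀)
      (by rw [card_range]) fun j hj => ?_
    have := congrFun h ⟨j, Finset.mem_range.1 hj⟩
    rw [hev₀_apply, hev₀_apply] at this
    rw [dotProduct_sub, this, sub_self]
  let u : (Idx n D → ℝ) →ₗ[ℝ] ℝ := (∑ j : Fin N₀, LinearMap.proj j) ∘ₗ ev₀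
  have hu : ∀ c, u c = ∑ j : Fin N₀, momentVector D (pt j) ⬝ᵥ c := fun c => by
    simp only [u, LinearMap.comp_apply, LinearMap.sum_apply, LinearMap.proj_apply, hev₀_apply]
  set Lev := levelAffineSubspace u 1 with hLev
  have hmemLev : ∀ c, c ∈ (Lev : Set (Idx n D → ℝ)) ↔ u c = 1 := fun c => Iff.rfl
  set C' : Set (Idx n D → ℝ) := coeffVec n D '' C with hC'
  have hsec : HasBlockPsdLift (C' ∩ (Lev : Set (Idx n D → ℝ))) k m :=
    (hlift.image (coeffVec n D)).inter_affineSubspace Lev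
  -- evaluations of members of `C` at the points `pt j` are nonnegative
  have hevC : ∀ p ∈ C, ∀ j, momentVector D (pt j) ⬝ᵥ coeffVec n D p = eval (pt j) p := fun p hp j =>
    (eval_eq_dotProduct (hCX hp).1 _).symm
  -- the base is bounded
  have hbdd : Bornology.IsBounded (C' ∩ (Lev : Set (Idx n D → ℝ))) := by
    let e : (Idx n D → ℝ) ≃ₗ[ℝ] (Fin N₀ → ℝ) :=
      ev₀.linearEquivOfInjective hev₀ (by simp [Module.finrank_fintype_fun_eq_card, hN₀])
    let ec := e.toContinuousLinearEquiv
    have hB : Bornology.IsBounded {v : Fin N₀ → ℝ | ∀ j, |v j| ≤ 1} := by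
      rw [isBounded_iff_forall_norm_le]
      refine ⟨1, fun v hv => (pi_norm_le_iff_of_nonneg zero_le_one).2 fun j => ?_⟩
      rw [Real.norm_eq_abs]; exact hv j
    refine ((ec.symm : (Fin N₀ → ℝ) →L[ℝ] (Idx n D → ℝ)).lipschitz.isBounded_image hB).subset ?_
    rintro c ⟨⟨p, hpC, rfl⟩, hc1⟩
    have hnn : ∀ j, 0 ≤ ev₀ (coeffVec n D p) j := fun j => by
      rw [hev₀_apply, hevC p hpC]
      exact (hCX hpC).2 _ (hmem _)
    have hsum1 : ∑ j, ev₀ (coeffVec n D p) j = 1 := by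
      have h := (hmemLev _).1 hc1
      rw [hu] at h
      simpa only [hev₀_apply] using h
    refine ⟨ec (coeffVec n D p), fun j => ?_, ec.symm_apply_apply _⟩
    change |e (coeffVec n D p) j| ≤ 1
    rw [LinearMap.linearEquivOfInjective_apply, abs_of_nonneg (hnn j), ← hsum1]
    exact single_le_sum (f := fun j => ev₀ (coeffVec n D p) j) (fun j _ => hnn j) (mem_univ j)
  refine not_hasBlockPsdLift_of_zeroPattern (σ := Fin n → ℝ) hbdd hk hm (fun N => ?_) hsec
  obtain ⟨S, hNS, hSX, hpat⟩ := hS (max N (k + 1))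
  -- choose the polynomials `f_T` of (∗)
  have hchoice : ∀ T : ↥(S.powersetCard k), ∃ f ∈ C, (∀ x ∈ (T : Finset (Fin n → ℝ)), eval x f = 0) ∧
      ∀ x ∈ S, x ∉ (T : Finset (Fin n → ℝ)) → 0 < eval x f := fun T => hpat T T.2
  choose g hgC hg0 hgpos using hchoice
  -- normalizing constants `Z_T = Σ_j f_T(pt j) > 0`
  let Z : ↥(S.powersetCard k) → ℝ := fun T => ∑ j : Fin N₀, eval (pt j) (g T)
  have hZ : ∀ T, 0 < Z T := by
    intro T
    obtain ⟨hTS, hTk⟩ := mem_powersetCard.1 T.2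
    obtain ⟨s, hsS, hsT⟩ : ∃ s ∈ S, s ∉ (T : Finset (Fin n → ℝ)) := by
      by_contra h
      push Not at h
      have h1 := card_le_card (show S ⊆ (T : Finset (Fin n → ℝ)) from h)
      have h2 := le_trans (le_max_right _ _) hNS
      omega
    have hg_ne : g T ≠ 0 := fun h0 => (hgpos T s hsS hsT).ne' (by rw [h0, map_zero])
    have hnn : ∀ j, 0 ≤ eval (pt j) (g T) := fun j => (hCX (hgC T)).2 _ (hmem _)
    by_contra hle
    push Not at hle
    have hZle : ∑ j : Fin N₀, eval (pt j) (g T) ≤ 0 := hle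
    have hall : ∀ j : Fin N₀, eval (pt j) (g T) = 0 := fun j =>
      le_antisymm (le_trans (single_le_sum (f := fun j : Fin N₀ => eval (pt j) (g T)) (fun j _ => hnn j)
        (mem_univ j)) hZle) (hnn j)
    apply hg_ne
    have hc0 : coeffVec n D (g T) = 0 := by
      refine hev₀ ?_
      rw [map_zero]
      funext j
      rw [hev₀_apply, hevC _ (hgC T), Pi.zero_apply]
      exact hall j
    rw [← ofVec_coeffVec (hCX (hgC T)).1, hc0, map_zero]
  -- the data of the zero pattern
  let f : Finset (Fin n → ℝ) → (Idx n D → ℝ) := fun T =>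
    if hT : T ∈ S.powersetCard k then (Z ⟨T, hT⟩)⁻¹ • coeffVec n D (g ⟨T, hT⟩) else 0
  let a : (Fin n → ℝ) → (Idx n D → ℝ) := fun s => -momentVector D s
  refine ⟨S, f, a, fun _ => 0, le_trans (le_max_left _ _) hNS, ?_, ?_, ?_⟩
  · -- `f_T / Z_T` lies in the base
    intro T hT
    simp only [f, dif_pos hT]
    refine ⟨⟨(Z ⟨T, hT⟩)⁻¹ • g ⟨T, hT⟩, hcone _ (hgC _) _ (inv_pos.2 (hZ _)), by rw [map_smul]⟩, ?_⟩
    rw [hmemLev, map_smul, smul_eq_mul, hu]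
    simp only [hevC _ (hgC _)]
    exact inv_mul_cancel₀ (hZ _).ne'
  · -- the evaluations `−f(s) ≤ 0` are valid on the base
    rintro s hs y ⟨⟨p, hpC, rfl⟩, -⟩
    simp only [a, neg_dotProduct]
    rw [← eval_eq_dotProduct (hCX hpC).1, neg_nonpos]
    exact (hCX hpC).2 s (hSX (mem_coe.2 hs))
  · -- the zero pattern `f_T(s) = 0 ⇔ s ∈ T`
    intro T hT s hs
    simp only [f, a, dif_pos hT, neg_dotProduct, dotProduct_smul, smul_eq_mul, neg_eq_zero, mul_eq_zero,
      inv_eq_zero, (hZ _).ne', false_or]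
    rw [← eval_eq_dotProduct (hCX (hgC _)).1]
    constructor
    · intro h0
      by_contra hsT
      exact (hgpos _ s hs hsT).ne' h0
    · intro hsT
      exact hg0 _ s hsT

/-! ### Corollary 3: `Σ_{n,2d} ⊆ C ⊆ P_{n,2d}(X)` forces `sxd(C) ≥ binom(n+d, n)` -/

/-- **Averkov 2019, Lemma 28**: "For every subset `S` of `ℝⁿ` of cardinality at most `binom(n+d,n) − 1` there
exists a non-zero polynomial `f ∈ ℝ[x]_d`, which is equal to zero on `S`" (an under-determined homogeneous
linear system in the coefficients). [cite: Averkov2019, Lemma 28 (p12)] -/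
theorem exists_ne_zero_eval_eq_zero {n d : ℕ} (T : Finset (Fin n → ℝ))
    (hT : T.card < Fintype.card (Idx n d)) :
    ∃ p : MvPolynomial (Fin n) ℝ, p ≠ 0 ∧ p.totalDegree ≤ d ∧ ∀ x ∈ T, eval x p = 0 := by
  classical
  let evT : (Idx n d → ℝ) →ₗ[ℝ] (↥T → ℝ) :=
    { toFun := fun c x => momentVector d (x : Fin n → ℝ) ⬝ᵥ c
      map_add' := fun c c' => funext fun x => dotProduct_add _ _ _
      map_smul' := fun r c => funext fun x => by
        simp only [dotProduct_smul, smul_eq_mul, RingHom.id_apply, Pi.smul_apply] }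
  have hker : LinearMap.ker evT ≠ ⊥ := LinearMap.ker_ne_bot_of_finrank_lt (by
    rw [Module.finrank_fintype_fun_eq_card, Module.finrank_fintype_fun_eq_card, Fintype.card_coe]
    exact hT)
  obtain ⟨c, hc, hc0⟩ := Submodule.exists_mem_ne_zero_of_ne_bot hker
  refine ⟨ofVec n d c, fun h => hc0 ((ofVec_eq_zero_iff c).1 h), totalDegree_ofVec_le c, fun x hx => ?_⟩
  rw [eval_ofVec]
  have := congrFun (LinearMap.mem_ker.1 hc) ⟨x, hx⟩
  exact this

/-- **The mechanism of Corollaries 3 and 5** ("we can adapt the proof of Corollary 3", p13): if `C ⊆ P_{n,D}(X)`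
is closed under positive scaling, `int X ≠ ∅`, `h ∈ ℝ[x]` is strictly positive on `X`, and `h q² ∈ C` for every
`q ∈ ℝ[x]_d`, then `C` has no `(S^k_+)^m`-lift for `k < |{α : |α| ≤ d}| = binom(n+d,n)`. Proof as printed
(§5, p12–p13): Thm. 2 with `k = binom(n+d,n) − 1`, `S` = `N` Kronecker points of `X` (Lemma 27),
`f_T = h p_T²` with `p_T ∈ ℝ[x]_d ∖ {0}` vanishing on `T` (Lemma 28), positive on `S ∖ T` by unisolvence.
[cite: Averkov2019, Cor. 3 and Cor. 5, proofs §5 (p12–p13)] -/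
theorem not_hasBlockPsdLift_of_mul_sq_mem {n d D k m : ℕ} {X : Set (Fin n → ℝ)} (hX : (interior X).Nonempty)
    {C : Set (MvPolynomial (Fin n) ℝ)} (hcone : ∀ p ∈ C, ∀ r : ℝ, 0 < r → r • p ∈ C)
    (hCX : C ⊆ nonnegPolynomialCone n D X) (h : MvPolynomial (Fin n) ℝ) (hpos : ∀ x ∈ X, 0 < eval x h)
    (hsq : ∀ q : MvPolynomial (Fin n) ℝ, q.totalDegree ≤ d → h * q ^ 2 ∈ C)
    (hk : k < Fintype.card (Idx n d)) : ¬ HasBlockPsdLift C k m := by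
  classical
  intro hlift
  set N := Fintype.card (Idx n d) with hN
  have hlift' : HasBlockPsdLift C (N - 1) m := hlift.mono_size (by omega)
  have h1C : h ∈ C := by simpa using hsq 1 (by simp)
  obtain ⟨x₀, hx₀⟩ := hX
  have hh0 : h ≠ 0 := fun h0 => (hpos x₀ (interior_subset hx₀)).ne' (by rw [h0, map_zero])
  rcases Nat.lt_or_ge 1 N with hN1 | hN1
  swap
  · have h' := hlift'.subset_zero_of_eq_zero (Or.inl (by omega)) h1C
    exact hh0 (Set.mem_singleton_iff.1 h')
  -- `N ≥ 2`, hence `n ≥ 1`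
  have hn : 0 < n := by
    by_contra hn0
    obtain rfl : n = 0 := by omega
    have hsub : Subsingleton (Idx 0 d) := ⟨fun β γ => Subtype.ext (funext fun i => i.elim0)⟩
    have := Fintype.card_le_one_iff_subsingleton.2 hsub
    omega
  refine not_hasBlockPsdLift_of_vanishingPattern (D := D) ⟨x₀, hx₀⟩ hcone hCX (fun M => ?_) hlift'
  obtain ⟨w, t, hw, ht0, ht, hmem⟩ := exists_kronPt_mem ⟨x₀, hx₀⟩ (d + 1)
  let pt : ℕ → (Fin n → ℝ) := fun j => kronPt w (d + 1) (t j)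
  have hpt : Function.Injective pt := by
    intro j j' h
    have h0 := congrFun h ⟨0, hn⟩
    simp only [pt, kronPt, pow_zero, pow_one] at h0
    exact ht (mul_left_cancel₀ (hw _) h0)
  refine ⟨(Finset.range M).image pt, by rw [card_image_of_injective _ hpt, card_range], ?_, ?_⟩
  · intro x hx
    obtain ⟨j, -, rfl⟩ := mem_image.1 (mem_coe.1 hx)
    exact hmem j
  intro T hT
  obtain ⟨hTS, hTk⟩ := mem_powersetCard.1 hT
  -- Lemma 28: a nonzero `p_T ∈ ℝ[x]_d` vanishing on `T`
  obtain ⟨p, hp0, hpd, hpT⟩ := exists_ne_zero_eval_eq_zero (d := d) T (by omega)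
  refine ⟨h * p ^ 2, hsq p hpd, fun x hx => by rw [map_mul, map_pow, hpT x hx, zero_pow two_ne_zero, mul_zero],
    fun s hs hsT => ?_⟩
  rw [map_mul, map_pow]
  have hsX : s ∈ X := by
    obtain ⟨j, -, rfl⟩ := mem_image.1 hs
    exact hmem j
  refine mul_pos (hpos s hsX) (lt_of_le_of_ne (sq_nonneg _) (Ne.symm (pow_ne_zero 2 fun h0 => hp0 ?_)))
  -- `p` vanishes on the `N` Kronecker points `insert s T`: it is zero (Lemma 27)
  let J := (Finset.range M).filter fun j => pt j ∈ insert s T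
  have hJ : J.image pt = insert s T := by
    ext x
    simp only [J, mem_image, mem_filter, mem_range]
    constructor
    · rintro ⟨j, ⟨-, hj⟩, rfl⟩; exact hj
    · intro hx
      have hxS : x ∈ (range M).image pt := by
        rcases mem_insert.1 hx with rfl | hxT
        · exact hs
        · exact hTS hxT
      obtain ⟨j, hj, rfl⟩ := mem_image.1 hxS
      exact ⟨j, ⟨mem_range.1 hj, hx⟩, rfl⟩
  have hc : coeffVec n d p = 0 := by
    refine eq_zero_of_dotProduct_kronPt_eq_zero (Nat.lt_succ_self d) hw ht0 ht J ?_ fun j hj => ?_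
    · rw [← card_image_of_injective J hpt, hJ, card_insert_of_notMem hsT, hTk]
      omega
    · have hj' : eval (pt j) p = 0 := by
        rcases mem_insert.1 (mem_filter.1 hj).2 with h | h
        · rw [h]; exact h0
        · exact hpT _ h
      rw [← eval_eq_dotProduct hpd]
      exact hj'
  rw [← ofVec_coeffVec hpd, hc, map_zero]

/-- **Averkov 2019, Corollary 3** (with the dimension `binom(n+d,n)` written as `|{α : |α| ≤ d}|`, see
`card_Idx`). "Let `X ⊆ ℝⁿ` be a set with non-empty interior and `C` be a closed convex cone satisfying
`Σ_{n,2d} ⊆ C ⊆ P_{n,2d}(X)`. Then `sxd(C) ≥ binom(n+d,n)`": `C` has no `(S^k_+)^m`-lift for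
`k < binom(n+d,n)` and any `m`. Typed for `C ⊆ P_{n,2d}(X)` closed under positive scaling and containing the
square of every `q ∈ ℝ[x]_d` (what `Σ_{n,2d} ⊆ C` is used for). Proof as printed (§5, p12): Thm. 2 with
`k = binom(n+d,n) − 1`, `S` = `N` Kronecker points of `X` (Lemma 27), `f_T = p_T²` with `p_T ∈ ℝ[x]_d ∖ {0}`
vanishing on `T` (Lemma 28), positive on `S ∖ T` by unisolvence (`not_hasBlockPsdLift_of_mul_sq_mem`, `h = 1`).
[cite: Averkov2019, Cor. 3 (p05), proof §5 (p12)] -/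
theorem not_hasBlockPsdLift_of_sq_mem' {n d k m : ℕ} {X : Set (Fin n → ℝ)} (hX : (interior X).Nonempty)
    {C : Set (MvPolynomial (Fin n) ℝ)} (hcone : ∀ p ∈ C, ∀ r : ℝ, 0 < r → r • p ∈ C)
    (hCX : C ⊆ nonnegPolynomialCone n (2 * d) X)
    (hsq : ∀ q : MvPolynomial (Fin n) ℝ, q.totalDegree ≤ d → q ^ 2 ∈ C)
    (hk : k < Fintype.card (Idx n d)) : ¬ HasBlockPsdLift C k m :=
  not_hasBlockPsdLift_of_mul_sq_mem hX hcone hCX 1 (fun x _ => by rw [map_one]; exact one_pos)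
    (fun q hq => by rw [one_mul]; exact hsq q hq) hk

/-- **Averkov 2019, Corollary 3.** "Let `X ⊆ ℝⁿ` be a set with non-empty interior and `C` be a closed convex
cone satisfying `Σ_{n,2d} ⊆ C ⊆ P_{n,2d}(X)`. Then `sxd(C) ≥ binom(n+d, n)`": such a `C` has no
`(S^k_+)^m`-lift for any `k < binom(n+d,n)` and any `m` (for `C ⊆ P_{n,2d}(X)` closed under positive
scaling and containing `q²` for every `q ∈ ℝ[x]_d`). [cite: Averkov2019, Cor. 3 (p05), proof §5 (p12)] -/
theorem not_hasBlockPsdLift_of_sq_mem {n d k m : ℕ} {X : Set (Fin n → ℝ)} (hX : (interior X).Nonempty)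
    {C : Set (MvPolynomial (Fin n) ℝ)} (hcone : ∀ p ∈ C, ∀ r : ℝ, 0 < r → r • p ∈ C)
    (hCX : C ⊆ nonnegPolynomialCone n (2 * d) X)
    (hsq : ∀ q : MvPolynomial (Fin n) ℝ, q.totalDegree ≤ d → q ^ 2 ∈ C)
    (hk : k < (n + d).choose n) : ¬ HasBlockPsdLift C k m :=
  not_hasBlockPsdLift_of_sq_mem' hX hcone hCX hsq (by rwa [card_Idx])

/-- **Averkov 2019, Corollary 3, verbatim form** `Σ ⊆ C ⊆ P` with `Σ` any set containing the squares of
`ℝ[x]_d` (e.g. `Σ_{n,2d}`, see `sq_mem_sosPolynomialCone`). [cite: Averkov2019, Cor. 3 (p05)] -/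
theorem not_hasBlockPsdLift_of_subset_of_subset {n d k m : ℕ} {X : Set (Fin n → ℝ)}
    (hX : (interior X).Nonempty) {Sig C : Set (MvPolynomial (Fin n) ℝ)}
    (hSig : ∀ q : MvPolynomial (Fin n) ℝ, q.totalDegree ≤ d → q ^ 2 ∈ Sig)
    (hcone : ∀ p ∈ C, ∀ r : ℝ, 0 < r → r • p ∈ C) (hSC : Sig ⊆ C)
    (hCX : C ⊆ nonnegPolynomialCone n (2 * d) X) (hk : k < (n + d).choose n) :
    ¬ HasBlockPsdLift C k m :=
  not_hasBlockPsdLift_of_sq_mem hX hcone hCX (fun q hq => hSC (hSig q hq)) hk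

/-! ### `Σ_{n,2d}`, its Gram representation (1.1), and Corollary 4 -/

/-- **`Σ_{n,2d} = {f ∈ ℝ[x]_{2d} : f is SOS}`**, where "a polynomial `f ∈ ℝ[x]` is called sum of squares (SOS)
if `f = f_1² + ⋯ + f_r²` holds for finitely many polynomials `f_1, …, f_r ∈ ℝ[x]`" (no degree bound on the
`f_i` is imposed in the definition; it is automatic, `totalDegree_le_of_sum_sq`).
[cite: Averkov2019, §1.2 (p03)] -/
def sosPolynomialCone (n d : ℕ) : Set (MvPolynomial (Fin n) ℝ) :=
  {p | p.totalDegree ≤ 2 * d ∧ ∃ (r : ℕ) (q : Fin r → MvPolynomial (Fin n) ℝ), p = ∑ j, q j ^ 2}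

/-- Membership in `Σ_{n,2d}`. [cite: Averkov2019, §1.2 (p03)] -/
theorem mem_sosPolynomialCone_iff {n d : ℕ} {p : MvPolynomial (Fin n) ℝ} :
    p ∈ sosPolynomialCone n d ↔
      p.totalDegree ≤ 2 * d ∧ ∃ (r : ℕ) (q : Fin r → MvPolynomial (Fin n) ℝ), p = ∑ j, q j ^ 2 :=
  Iff.rfl

/-- The square of a polynomial of degree `≤ d` lies in `Σ_{n,2d}`. [cite: Averkov2019, §1.2 (p03)] -/
theorem sq_mem_sosPolynomialCone {n d : ℕ} (q : MvPolynomial (Fin n) ℝ) (hq : q.totalDegree ≤ d) :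
    q ^ 2 ∈ sosPolynomialCone n d :=
  ⟨(totalDegree_pow q 2).trans (by omega), 1, fun _ => q, by simp⟩

/-- `Σ_{n,2d}` is closed under multiplication by positive (indeed nonnegative) scalars:
`r Σ_j q_j² = Σ_j (√r q_j)²`. [cite: Averkov2019, §1.2 (p03)] -/
theorem smul_mem_sosPolynomialCone {n d : ℕ} {p : MvPolynomial (Fin n) ℝ} (hp : p ∈ sosPolynomialCone n d)
    {r : ℝ} (hr : 0 ≤ r) : r • p ∈ sosPolynomialCone n d := by
  obtain ⟨hdeg, k, q, rfl⟩ := hp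
  refine ⟨(totalDegree_smul_le _ _).trans hdeg, k, fun j => Real.sqrt r • q j, ?_⟩
  rw [Finset.smul_sum]
  refine sum_congr rfl fun j _ => ?_
  rw [smul_pow, Real.sq_sqrt hr]

/-- `Σ_{n,2d} ⊆ P_{n,2d}(X)` for every `X` ("the obvious inclusion `Σ_{n,2d} ⊆ P_{n,2d}`").
[cite: Averkov2019, §1.2 (p03)] -/
theorem sosPolynomialCone_subset_nonnegPolynomialCone (n d : ℕ) (X : Set (Fin n → ℝ)) :
    sosPolynomialCone n d ⊆ nonnegPolynomialCone n (2 * d) X := by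
  rintro p ⟨hdeg, k, q, rfl⟩
  refine ⟨hdeg, fun x _ => ?_⟩
  rw [map_sum]
  exact sum_nonneg fun j _ => by rw [map_pow]; exact sq_nonneg _

/-- The top homogeneous component of a nonzero polynomial is nonzero. [folklore] -/
private theorem homogeneousComponent_totalDegree_ne_zero {n : ℕ} {p : MvPolynomial (Fin n) ℝ} (hp : p ≠ 0) :
    homogeneousComponent p.totalDegree p ≠ 0 := by
  classical
  obtain ⟨s, hs, hsup⟩ := Finset.exists_mem_eq_sup p.support (support_nonempty.2 hp)
    (fun s => s.sum fun _ e => e)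
  intro h
  have hc := congrArg (coeff s) h
  rw [coeff_homogeneousComponent, coeff_zero, if_pos] at hc
  · exact (mem_support_iff.1 hs) hc
  · rw [totalDegree, hsup]
    rfl

/-- A polynomial is the sum of its homogeneous components of degrees `≤ D` whenever `deg ≤ D`. [folklore] -/
private theorem sum_homogeneousComponent_of_le {n D : ℕ} {q : MvPolynomial (Fin n) ℝ} (hq : q.totalDegree ≤ D) :
    ∑ i ∈ range (D + 1), homogeneousComponent i q = q := by
  rw [← sum_subset (range_subset_range.2 (Nat.succ_le_succ hq)) fun i _ hi => ?_]
  · exact sum_homogeneousComponent q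
  · exact homogeneousComponent_eq_zero _ _ (by
      have := mem_range.not.1 hi
      omega)

/-- The degree-`2D` component of `q²` is `(q_D)²` when `deg q ≤ D` (`q_D` the degree-`D` component).
[folklore] -/
private theorem homogeneousComponent_two_mul_sq {n D : ℕ} {q : MvPolynomial (Fin n) ℝ}
    (hq : q.totalDegree ≤ D) :
    homogeneousComponent (2 * D) (q ^ 2) = homogeneousComponent D q ^ 2 := by
  set ψ : ℕ → MvPolynomial (Fin n) ℝ := fun i => homogeneousComponent i q with hψ
  have hψh : ∀ i, ψ i ∈ homogeneousSubmodule (Fin n) ℝ i := fun i =>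
    (mem_homogeneousSubmodule _ _).2 (homogeneousComponent_isHomogeneous i q)
  have hdecomp := sum_homogeneousComponent_of_le hq
  calc homogeneousComponent (2 * D) (q ^ 2)
      = homogeneousComponent (2 * D)
          ((∑ i ∈ range (D + 1), ψ i) * ∑ i' ∈ range (D + 1), ψ i') := by rw [hdecomp, sq]
    _ = ∑ i ∈ range (D + 1), ∑ i' ∈ range (D + 1), homogeneousComponent (2 * D) (ψ i * ψ i') := by
        rw [sum_mul_sum, map_sum]
        exact sum_congr rfl fun i _ => map_sum _ _ _
    _ = ∑ i ∈ range (D + 1), ∑ i' ∈ range (D + 1), (if 2 * D = i + i' then ψ i * ψ i' else 0) := by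
        refine sum_congr rfl fun i _ => sum_congr rfl fun i' _ => ?_
        exact homogeneousComponent_of_mem (homogeneousSubmodule_mul i i' (Submodule.mul_mem_mul (hψh i) (hψh i')))
    _ = ψ D * ψ D := by
        rw [Finset.sum_eq_single D]
        · rw [Finset.sum_eq_single D]
          · rw [if_pos (by ring)]
          · intro i' hi' hne
            rw [if_neg]
            have := mem_range.1 hi'
            omega
          · intro h; exact absurd (mem_range.2 (Nat.lt_succ_self D)) h
        · intro i hi hne
          refine sum_eq_zero fun i' hi' => ?_
          rw [if_neg]
          have := mem_range.1 hi
          have := mem_range.1 hi'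
          omega
        · intro h; exact absurd (mem_range.2 (Nat.lt_succ_self D)) h
    _ = homogeneousComponent D q ^ 2 := by rw [sq]

/-- **In an SOS representation of a polynomial of degree `≤ 2d` every square has degree `≤ d`**: over `ℝ` the top
homogeneous components `(q_j)_D`, `D = max_j deg q_j`, satisfy `Σ_j (q_j)_D² ≠ 0` (a sum of squares of real
forms, not all zero, does not vanish identically), so `deg Σ_j q_j² = 2D`. This is why Averkov's
`Σ_{n,2d} ⊆ ℝ[x]_{2d}` is the image of the Gram map of size `binom(n+d,n)`, (1.1).
[cite: Averkov2019, §1.2 (p03), (1.1)] -/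
theorem totalDegree_le_of_sum_sq {n d r : ℕ} {q : Fin r → MvPolynomial (Fin n) ℝ}
    (h : (∑ j, q j ^ 2).totalDegree ≤ 2 * d) (j : Fin r) : (q j).totalDegree ≤ d := by
  classical
  set D := Finset.univ.sup fun j => (q j).totalDegree with hD
  have hle : ∀ j, (q j).totalDegree ≤ D := fun j => Finset.le_sup (f := fun j => (q j).totalDegree) (mem_univ j)
  by_contra hjd
  push Not at hjd
  -- `D > d`, attained at some `j₀` with `q j₀ ≠ 0`
  have hDd : d < D := lt_of_lt_of_le hjd (hle j)
  obtain ⟨j₀, -, hj₀⟩ := Finset.exists_mem_eq_sup (Finset.univ : Finset (Fin r)) ⟨j, mem_univ j⟩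
    fun j => (q j).totalDegree
  rw [← hD] at hj₀
  have hq₀ : q j₀ ≠ 0 := by
    intro h0
    rw [h0, totalDegree_zero] at hj₀
    omega
  -- the top components
  set φ : Fin r → MvPolynomial (Fin n) ℝ := fun j => homogeneousComponent D (q j) with hφ
  have hφ₀ : φ j₀ ≠ 0 := by
    simp only [φ, hj₀]
    exact homogeneousComponent_totalDegree_ne_zero hq₀
  have htop : homogeneousComponent (2 * D) (∑ j, q j ^ 2) = ∑ j, φ j ^ 2 := by
    rw [map_sum]
    exact sum_congr rfl fun j _ => homogeneousComponent_two_mul_sq (hle j)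
  -- it vanishes since `deg Σ q_j² ≤ 2d < 2D` …
  have hzero : ∑ j, φ j ^ 2 = 0 := by
    rw [← htop]
    exact homogeneousComponent_eq_zero _ _ (by omega)
  -- … but a sum of squares of real forms with `φ j₀ ≠ 0` is not the zero polynomial
  apply hφ₀
  refine (homogeneousComponent_isHomogeneous D (q j₀)).eq_zero_of_forall_eval_eq_zero fun x => ?_
  have hx := congrArg (eval x) hzero
  rw [map_sum, map_zero] at hx
  have hx' : ∑ j, (eval x (φ j)) ^ 2 = 0 := by
    rw [← hx]; exact sum_congr rfl fun j _ => (map_pow _ _ _).symm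
  exact pow_eq_zero_iff two_ne_zero |>.1
    ((sum_eq_zero_iff_of_nonneg fun j _ => sq_nonneg (eval x (φ j))).1 hx' j₀ (mem_univ j₀))

/-- Every element of `Σ_{n,2d}` is a finite sum of squares of polynomials of degree `≤ d`.
[cite: Averkov2019, §1.2 (p03), (1.1)] -/
theorem exists_eq_sum_sq_of_mem_sosPolynomialCone {n d : ℕ} {p : MvPolynomial (Fin n) ℝ}
    (hp : p ∈ sosPolynomialCone n d) :
    ∃ (r : ℕ) (q : Fin r → MvPolynomial (Fin n) ℝ), (∀ j, (q j).totalDegree ≤ d) ∧ p = ∑ j, q j ^ 2 := by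
  obtain ⟨hdeg, r, q, rfl⟩ := hp
  exact ⟨r, q, totalDegree_le_of_sum_sq hdeg, rfl⟩

namespace SosCone

/-- The monomial `x^β`. [folklore] -/
def mono {n d : ℕ} (β : Idx n d) : MvPolynomial (Fin n) ℝ := monomial β.toFinsupp 1

/-- `Σ_β c_β x^β = ofVec c`, summed over an enumeration `Fin N ≃ Idx n d` of the monomials. [folklore] -/
private theorem sum_smul_mono_equiv {n d : ℕ} (e : Idx n d ≃ Fin (Fintype.card (Idx n d)))
    (c : Fin (Fintype.card (Idx n d)) → ℝ) :
    ∑ i, c i • mono (e.symm i) = ofVec n d (fun β => c (e β)) := by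
  rw [ofVec_apply, ← e.symm.sum_comp]
  refine sum_congr rfl fun i _ => ?_
  rw [mono, smul_monomial, smul_eq_mul, mul_one, Equiv.apply_symm_apply]

/-- **The Gram map `A ↦ v_{n,d}ᵀ A v_{n,d} = Σ_{α,β} A_{αβ} x^{α+β}`** of (1.1), on `binom(n+d,n) × binom(n+d,n)`
matrices indexed by an enumeration of the monomials of degree `≤ d`. [cite: Averkov2019, (1.1) (p03)] -/
def gramMap (n d : ℕ) :
    Matrix (Fin (Fintype.card (Idx n d))) (Fin (Fintype.card (Idx n d))) ℝ →ₗ[ℝ] MvPolynomial (Fin n) ℝ where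
  toFun A := ∑ i, ∑ j, A i j • (mono ((Fintype.equivFin (Idx n d)).symm i) *
    mono ((Fintype.equivFin (Idx n d)).symm j))
  map_add' A A' := by
    simp only [Matrix.add_apply, add_smul, sum_add_distrib]
  map_smul' a A := by
    simp only [Matrix.smul_apply, smul_eq_mul, mul_smul, RingHom.id_apply, Finset.smul_sum]

/-- `v ᵀ(BᵀB) v = Σ_l (B v)_l²`: the Gram map of `BᵀB` is the sum of the squares of the polynomials with
coefficient rows `B_l`. [cite: Averkov2019, (1.1) (p03)] -/
theorem gramMap_transpose_mul_self {n d r : ℕ} (B : Matrix (Fin r) (Fin (Fintype.card (Idx n d))) ℝ) :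
    gramMap n d (Bᵀ * B) = ∑ l, (ofVec n d fun β => B l (Fintype.equivFin (Idx n d) β)) ^ 2 := by
  set e := Fintype.equivFin (Idx n d) with he
  have hsq : ∀ l, (ofVec n d fun β => B l (e β)) ^ 2 =
      ∑ i, ∑ j, (B l i * B l j) • (mono (e.symm i) * mono (e.symm j)) := by
    intro l
    rw [← sum_smul_mono_equiv e, sq, sum_mul_sum]
    exact sum_congr rfl fun i _ => sum_congr rfl fun j _ => smul_mul_smul_comm _ _ _ _
  simp only [hsq]
  rw [Finset.sum_comm]
  change ∑ i, ∑ j, (Bᵀ * B) i j • _ = _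
  refine sum_congr rfl fun i _ => ?_
  rw [Finset.sum_comm]
  refine sum_congr rfl fun j _ => ?_
  rw [Matrix.mul_apply, Finset.sum_smul]
  rfl

/-- The Gram map takes values in `ℝ[x]_{2d}`. [cite: Averkov2019, (1.1) (p03)] -/
theorem totalDegree_gramMap_le {n d : ℕ} (A : Matrix (Fin (Fintype.card (Idx n d))) (Fin (Fintype.card (Idx n d))) ℝ) :
    (gramMap n d A).totalDegree ≤ 2 * d := by
  refine totalDegree_finsetSum_le fun i _ => totalDegree_finsetSum_le fun j _ => ?_
  refine (totalDegree_smul_le _ _).trans ?_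
  rw [mono, mono, monomial_mul]
  refine (totalDegree_monomial_le _ _).trans ?_
  have h1 := Idx.sum_toFinsupp_le ((Fintype.equivFin (Idx n d)).symm i)
  have h2 := Idx.sum_toFinsupp_le ((Fintype.equivFin (Idx n d)).symm j)
  rw [Finsupp.sum_add_index' (fun _ => rfl) (fun _ _ _ => rfl)]
  change (Finsupp.sum _ fun _ e => e) + (Finsupp.sum _ fun _ e => e) ≤ 2 * d
  omega

end SosCone

/-- **(1.1): `Σ_{n,2d} = {v_{n,d}ᵀ A v_{n,d} : A ∈ S^k_+}`, `k = binom(n+d,n)` — `Σ_{n,2d}` has a semidefinite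
extended formulation with ONE LMI of size `binom(n+d,n)`**, whence `sxd(Σ_{n,2d}) ≤ sxc(Σ_{n,2d}) ≤ binom(n+d,n)`
(1.3). (`⊆`: a psd `A` is `BᵀB`, `B = A^{1/2}`, and `vᵀBᵀBv = Σ_l (Bv)_l²`; `⊇`: `Σ_j q_j²` with
`deg q_j ≤ d` (`totalDegree_le_of_sum_sq`) is the Gram map of `Σ_j q_j q_jᵀ` in coefficient coordinates.)
The block size is written `|{α : |α| ≤ d}|`; see `SosCone.card_Idx`. [cite: Averkov2019, (1.1) and (1.3) (p03)] -/
theorem hasBlockPsdLift_sosPolynomialCone (n d : ℕ) :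
    HasBlockPsdLift (sosPolynomialCone n d) (Fintype.card (Idx n d)) 1 := by
  classical
  set N := Fintype.card (Idx n d) with hN
  set e := Fintype.equivFin (Idx n d) with he
  refine ⟨⊤, SosCone.gramMap n d ∘ₗ LinearMap.proj 0, ?_⟩
  ext p
  constructor
  · intro hp
    obtain ⟨r, q, hqd, rfl⟩ := exists_eq_sum_sq_of_mem_sosPolynomialCone hp
    -- `A = BᵀB`, `B_{lβ} = (q_l)_β`
    let B : Matrix (Fin r) (Fin N) ℝ := fun l i => coeffVec n d (q l) (e.symm i)
    refine ⟨fun _ => Bᵀ * B, ⟨fun _ => ?_, AffineSubspace.mem_top ℝ _ _⟩, ?_⟩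
    · have h := posSemidef_conjTranspose_mul_self B
      rwa [conjTranspose_eq_transpose_of_trivial] at h
    · change SosCone.gramMap n d (Bᵀ * B) = ∑ j, q j ^ 2
      rw [SosCone.gramMap_transpose_mul_self]
      refine sum_congr rfl fun l _ => ?_
      have : (fun β => B l (e β)) = coeffVec n d (q l) := funext fun β => by
        simp only [B, Equiv.symm_apply_apply]
      rw [this, ofVec_coeffVec (hqd l)]
  · rintro ⟨M, ⟨hM, -⟩, rfl⟩
    change SosCone.gramMap n d (M 0) ∈ sosPolynomialCone n d
    -- `M 0 = BᵀB` with `B` its psd square root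
    have h0 : 0 ≤ M 0 := Matrix.nonneg_iff_posSemidef.2 (hM 0)
    set B := CFC.sqrt (M 0) with hB
    have h1 : B * B = M 0 := CFC.sqrt_mul_sqrt_self (M 0) h0
    have h2 : B.IsHermitian := (Matrix.nonneg_iff_posSemidef.1 (CFC.sqrt_nonneg (M 0))).1
    have h3 : M 0 = Bᵀ * B := by
      rw [← conjTranspose_eq_transpose_of_trivial, h2.eq, h1]
    refine ⟨SosCone.totalDegree_gramMap_le _, N, fun l => ofVec n d fun β => B l (e β), ?_⟩
    rw [h3, SosCone.gramMap_transpose_mul_self]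

/-- **Averkov 2019, Corollary 3 for `C = Σ_{n,2d}` (the lower bound of Corollary 4)**: `Σ_{n,2d}` has no
`(S^k_+)^m`-lift for `k < binom(n+d,n)`, whatever the number `m` of blocks. [cite: Averkov2019, Cor. 3 and Cor. 4 (p05)] -/
theorem not_hasBlockPsdLift_sosPolynomialCone {n d k : ℕ} (hk : k < (n + d).choose n) (m : ℕ) :
    ¬ HasBlockPsdLift (sosPolynomialCone n d) k m :=
  not_hasBlockPsdLift_of_sq_mem (X := Set.univ) (by rw [interior_univ]; exact Set.univ_nonempty)
    (fun _ hp _ hr => smul_mem_sosPolynomialCone hp hr.le)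
    (sosPolynomialCone_subset_nonnegPolynomialCone n d Set.univ) (fun q hq => sq_mem_sosPolynomialCone q hq) hk

/-- **Averkov 2019, Corollary 4: `sxd(Σ_{n,2d}) = sxc(Σ_{n,2d}) = binom(n+d, n)`** — the least block size `k` for
which the cone of `n`-variate SOS polynomials of degree `≤ 2d` has an `(S^k_+)^m`-lift for some `m` is
`binom(n+d,n)`, and it is attained with one block (`hasBlockPsdLift_sosPolynomialCone`): "the straightforward
extended formulation is optimal in terms of the size of the LMIs". The case `n = 1` is
`isLeast_blockSize_hasBlockPsdLift_nonnegPolyCoeff`; `d = 1` is Corollary 6, `sxd(S^k_+) = k`.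
[cite: Averkov2019, Cor. 4 (p05), proof §5 (p12)] -/
theorem isLeast_blockSize_hasBlockPsdLift_sosPolynomialCone (n d : ℕ) :
    IsLeast {k : ℕ | ∃ m : ℕ, HasBlockPsdLift (sosPolynomialCone n d) k m} ((n + d).choose n) := by
  refine ⟨⟨1, by rw [← SosCone.card_Idx]; exact hasBlockPsdLift_sosPolynomialCone n d⟩, fun k hk => ?_⟩
  obtain ⟨m, hm⟩ := hk
  by_contra hlt
  exact not_hasBlockPsdLift_sosPolynomialCone (not_le.1 hlt) m hm

/-- **Averkov 2019, Corollary 4, the semidefinite extension complexity**: the least size `k` of a single LMI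
lifting `Σ_{n,2d}` (an `S^k_+`-lift, the tree's `HasPsdLift`) is also `binom(n+d,n)` (`sxd ≤ sxc` and (1.1)).
[cite: Averkov2019, Cor. 4 (p05), (1.3) (p03)] -/
theorem isLeast_size_hasPsdLift_sosPolynomialCone (n d : ℕ) :
    IsLeast {k : ℕ | HasPsdLift (sosPolynomialCone n d) k} ((n + d).choose n) := by
  refine ⟨?_, fun k hk => ?_⟩
  · rw [Set.mem_setOf_eq, ← hasBlockPsdLift_one_iff, ← SosCone.card_Idx]
    exact hasBlockPsdLift_sosPolynomialCone n d
  · by_contra hlt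
    exact not_hasBlockPsdLift_sosPolynomialCone (not_le.1 hlt) 1 (hasBlockPsdLift_one_iff.2 hk)

/-! ### Corollary 5: truncated quadratic modules -/

/-- **A nonzero polynomial does not vanish identically on a set with non-empty interior** ("since `g_i` is not a
zero polynomial, the set `{x ∈ X : g_i(x) ≠ 0}` is `n`-dimensional", p13) — via unisolvent Kronecker points in
the interior (`SosCone.exists_kronPt_mem`, `SosCone.eq_zero_of_dotProduct_kronPt_eq_zero`).
[cite: Averkov2019, proof of Cor. 5 (p13)] -/
theorem eq_zero_of_eval_eq_zero_of_interior_nonempty {n : ℕ} {U : Set (Fin n → ℝ)}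
    (hU : (interior U).Nonempty) {g : MvPolynomial (Fin n) ℝ} (hg : ∀ x ∈ U, eval x g = 0) : g = 0 := by
  classical
  set D := g.totalDegree with hD
  obtain ⟨w, t, hw, ht0, ht, hmem⟩ := exists_kronPt_mem hU (D + 1)
  have hc : coeffVec n D g = 0 :=
    eq_zero_of_dotProduct_kronPt_eq_zero (Nat.lt_succ_self D) hw ht0 ht (Finset.range (Fintype.card (Idx n D)))
      (by rw [card_range]) fun j _ => by rw [← eval_eq_dotProduct hD.symm.le]; exact hg _ (hmem j)
  rw [← ofVec_coeffVec hD.symm.le, hc, map_zero]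

/-- For `X` with non-empty interior and a nonzero polynomial `g`, the set `{x ∈ X : g(x) ≠ 0}` still has non-empty
interior. [cite: Averkov2019, proof of Cor. 5 (p13)] -/
theorem interior_inter_eval_ne_zero_nonempty {n : ℕ} {X : Set (Fin n → ℝ)} (hX : (interior X).Nonempty)
    {g : MvPolynomial (Fin n) ℝ} (hg : g ≠ 0) : (interior (X ∩ {x | eval x g ≠ 0})).Nonempty := by
  -- some point of `interior X` where `g ≠ 0`
  obtain ⟨y, hyX, hyg⟩ : ∃ y ∈ interior X, eval y g ≠ 0 := by
    by_contra hall
    push Not at hall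
    exact hg (eq_zero_of_eval_eq_zero_of_interior_nonempty (U := interior X) (by rwa [interior_interior]) hall)
  have hopen : IsOpen {x : Fin n → ℝ | eval x g ≠ 0} :=
    isOpen_ne_fun (MvPolynomial.continuous_eval g) continuous_const
  refine ⟨y, ?_⟩
  rw [interior_inter, hopen.interior_eq]
  exact ⟨hyX, hyg⟩

open scoped Pointwise

/-- **The truncated quadratic module `Σ_{n,2d₀} + g_1 Σ_{n,2d_1} + ⋯ + g_k Σ_{n,2d_k}`** generated by
`g_1, …, g_k` with truncation degrees `2d_0, …, 2d_k` ((1.5) p04; `g C = {g p : p ∈ C}`, §3.1 p08; Minkowski sum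
of sets). [cite: Averkov2019, (1.5) (p04) and Cor. 5 (p05)] -/
def truncatedQuadraticModule {n k : ℕ} (d₀ : ℕ) (g : Fin k → MvPolynomial (Fin n) ℝ) (dg : Fin k → ℕ) :
    Set (MvPolynomial (Fin n) ℝ) :=
  sosPolynomialCone n d₀ + ∑ i, (fun s => g i * s) '' sosPolynomialCone n (dg i)

/-- Membership in the truncated quadratic module: `p = s₀ + Σ_i g_i s_i` with `s₀ ∈ Σ_{n,2d₀}`, `s_i ∈ Σ_{n,2d_i}`.
[cite: Averkov2019, (1.5) (p04)] -/
theorem mem_truncatedQuadraticModule_iff {n k d₀ : ℕ} {g : Fin k → MvPolynomial (Fin n) ℝ} {dg : Fin k → ℕ}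
    {p : MvPolynomial (Fin n) ℝ} :
    p ∈ truncatedQuadraticModule d₀ g dg ↔ ∃ s₀ ∈ sosPolynomialCone n d₀, ∃ s : Fin k → MvPolynomial (Fin n) ℝ,
      (∀ i, s i ∈ sosPolynomialCone n (dg i)) ∧ p = s₀ + ∑ i, g i * s i := by
  classical
  rw [truncatedQuadraticModule, Set.mem_add]
  constructor
  · rintro ⟨s₀, hs₀, q, hq, rfl⟩
    obtain ⟨f, hf, rfl⟩ := (Set.mem_finsetSum _ _ _).1 hq
    have hf' : ∀ i, ∃ si ∈ sosPolynomialCone n (dg i), g i * si = f i := fun i =>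
      (Set.mem_image _ _ _).1 (hf (mem_univ i))
    choose si hsi hgsi using hf'
    exact ⟨s₀, hs₀, si, hsi, by simp only [hgsi]⟩
  · rintro ⟨s₀, hs₀, si, hsi, rfl⟩
    exact ⟨s₀, hs₀, ∑ i, g i * si i,
      (Set.mem_finsetSum _ _ _).2 ⟨fun i => g i * si i, fun {i} _ => ⟨si i, hsi i, rfl⟩, rfl⟩, rfl⟩

/-- `0 ∈ Σ_{n,2d}` (the empty sum of squares). [cite: Averkov2019, §1.2 (p03)] -/
theorem zero_mem_sosPolynomialCone (n d : ℕ) : (0 : MvPolynomial (Fin n) ℝ) ∈ sosPolynomialCone n d :=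
  ⟨by simp, 0, fun i => i.elim0, by simp⟩

/-- An `(S^d_+)^0`-lift of `{0}` (the empty Minkowski sum). [cite: GouveiaParriloThomas2013, Def. 2.2 (§2)] -/
theorem hasBlockPsdLift_zero {E : Type*} [AddCommGroup E] [Module ℝ E] (d : ℕ) :
    HasBlockPsdLift (0 : Set E) d 0 := by
  refine ⟨⊤, 0, ?_⟩
  ext y
  simp only [Set.mem_zero, Set.mem_image, Set.mem_setOf_eq, LinearMap.zero_apply]
  constructor
  · rintro rfl
    exact ⟨fun t => t.elim0, ⟨fun t => t.elim0, AffineSubspace.mem_top ℝ _ _⟩, rfl⟩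
  · rintro ⟨_, -, rfl⟩; rfl

/-- **Lemma 31 (sums)**: "`sxd(C_1 + ⋯ + C_k) ≤ max sxd(C_i)`" — a Minkowski sum of `|s|` sets with one-block
lifts of size `N` has an `(S^N_+)^{|s|}`-lift (`HasBlockPsdLift.add`). [cite: Averkov2019, Lemma 31 (p12)] -/
theorem hasBlockPsdLift_finsetSum {E : Type*} [AddCommGroup E] [Module ℝ E] {ι : Type*} (s : Finset ι)
    (C : ι → Set E) {N : ℕ} (h : ∀ i ∈ s, HasBlockPsdLift (C i) N 1) :
    HasBlockPsdLift (∑ i ∈ s, C i) N s.card := by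
  classical
  induction s using Finset.cons_induction with
  | empty => simpa using hasBlockPsdLift_zero (E := E) N
  | cons a s has ih =>
    rw [Finset.sum_cons, Finset.card_cons, add_comm s.card 1]
    exact (h a (Finset.mem_cons_self a s)).add (ih fun i hi => h i (Finset.mem_cons_of_mem hi))

/-- The truncated quadratic module is closed under positive scaling. [cite: Averkov2019, (1.5) (p04)] -/
theorem smul_mem_truncatedQuadraticModule {n k d₀ : ℕ} {g : Fin k → MvPolynomial (Fin n) ℝ} {dg : Fin k → ℕ}
    {p : MvPolynomial (Fin n) ℝ} (hp : p ∈ truncatedQuadraticModule d₀ g dg) {r : ℝ} (hr : 0 ≤ r) :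
    r • p ∈ truncatedQuadraticModule d₀ g dg := by
  obtain ⟨s₀, hs₀, s, hs, rfl⟩ := mem_truncatedQuadraticModule_iff.1 hp
  refine mem_truncatedQuadraticModule_iff.2 ⟨r • s₀, smul_mem_sosPolynomialCone hs₀ hr, fun i => r • s i,
    fun i => smul_mem_sosPolynomialCone (hs i) hr, ?_⟩
  rw [smul_add, Finset.smul_sum]
  refine congrArg _ (sum_congr rfl fun i _ => ?_)
  rw [mul_smul_comm]

/-- The truncated quadratic module of `X = {g_1 ≥ 0, …, g_k ≥ 0}` lies in `P_{n,D}(X)` for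
`D = max(2d₀, max_i (deg g_i + 2d_i))`. [cite: Averkov2019, §1.2 (p04, "a cone `C` contained in `P_{n,2d}(X)`")] -/
theorem truncatedQuadraticModule_subset_nonnegPolynomialCone {n k : ℕ} (d₀ : ℕ) (g : Fin k → MvPolynomial (Fin n) ℝ)
    (dg : Fin k → ℕ) :
    truncatedQuadraticModule d₀ g dg ⊆ nonnegPolynomialCone n
      (max (2 * d₀) (Finset.univ.sup fun i => (g i).totalDegree + 2 * dg i)) {x | ∀ i, 0 ≤ eval x (g i)} := by
  intro p hp
  obtain ⟨s₀, hs₀, s, hs, rfl⟩ := mem_truncatedQuadraticModule_iff.1 hp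
  refine ⟨(totalDegree_add _ _).trans (max_le_max hs₀.1 (totalDegree_finsetSum_le fun i _ => ?_)), fun x hx => ?_⟩
  · refine (totalDegree_mul _ _).trans ?_
    exact le_trans (Nat.add_le_add_left (hs i).1 _)
      (Finset.le_sup (f := fun i => (g i).totalDegree + 2 * dg i) (mem_univ i))
  · rw [map_add, map_sum]
    refine add_nonneg ((sosPolynomialCone_subset_nonnegPolynomialCone n d₀ Set.univ hs₀).2 x trivial)
      (sum_nonneg fun i _ => ?_)
    rw [map_mul]
    exact mul_nonneg (hx i) ((sosPolynomialCone_subset_nonnegPolynomialCone n (dg i) Set.univ (hs i)).2 x trivial)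

/-- **Averkov 2019, Corollary 5, upper bound**: the truncated quadratic module "has a straightforward semidefinite
extended formulation with `k + 1` LMIs of sizes `binom(n+d₀,n), …, binom(n+d_k,n)`", hence an
`(S^N_+)^{k+1}`-lift with `N = binom(n+d,n)`, `d = max{d₀, …, d_k}` (Lemma 31 and (1.1)).
[cite: Averkov2019, Cor. 5 (p05), Lemma 31 (p12), proof §5 (p13)] -/
theorem hasBlockPsdLift_truncatedQuadraticModule {n k : ℕ} (d₀ : ℕ) (g : Fin k → MvPolynomial (Fin n) ℝ)
    (dg : Fin k → ℕ) :
    HasBlockPsdLift (truncatedQuadraticModule d₀ g dg) ((n + max d₀ (Finset.univ.sup dg)).choose n) (1 + k) := by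
  set d := max d₀ (Finset.univ.sup dg) with hd
  have hmono : ∀ d', d' ≤ d → Fintype.card (Idx n d') ≤ (n + d).choose n := fun d' hd' => by
    rw [card_Idx]; exact Nat.choose_le_choose n (by omega)
  have h₀ : HasBlockPsdLift (sosPolynomialCone n d₀) ((n + d).choose n) 1 :=
    (hasBlockPsdLift_sosPolynomialCone n d₀).mono_size (hmono d₀ (le_max_left _ _))
  have h₁ : HasBlockPsdLift (∑ i, (fun s => g i * s) '' sosPolynomialCone n (dg i)) ((n + d).choose n) k := by
    have := hasBlockPsdLift_finsetSum (Finset.univ : Finset (Fin k))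
      (fun i => (fun s => g i * s) '' sosPolynomialCone n (dg i)) (N := (n + d).choose n) fun i _ => ?_
    · rwa [Finset.card_univ, Fintype.card_fin] at this
    · have h := ((hasBlockPsdLift_sosPolynomialCone n (dg i)).mono_size
        (hmono (dg i) (le_trans (Finset.le_sup (f := dg) (mem_univ i)) (le_max_right _ _)))).image
        (LinearMap.mulLeft ℝ (g i))
      exact h
  exact h₀.add h₁

/-- **Averkov 2019, Corollary 5, lower bound**: for nonzero `g_1, …, g_k` with `X = {g_1 ≥ 0, …, g_k ≥ 0}` of
non-empty interior, the truncated quadratic module has no `(S^K_+)^m`-lift for `K < binom(n+d,n)`,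
`d = max{d₀, …, d_k}`: "fix `i` with `d_i = d` … points `x^1, …, x^N` … with `g_i(x^j) ≠ 0` … the polynomials
`g_i f_T²` vanish on `T` and are strictly positive on `S ∖ T`". [cite: Averkov2019, Cor. 5 (p05), proof §5 (p13)] -/
theorem not_hasBlockPsdLift_truncatedQuadraticModule {n k : ℕ} (d₀ : ℕ) {g : Fin k → MvPolynomial (Fin n) ℝ}
    (hg : ∀ i, g i ≠ 0) (hX : (interior {x : Fin n → ℝ | ∀ i, 0 ≤ eval x (g i)}).Nonempty) (dg : Fin k → ℕ)
    {K : ℕ} (hK : K < (n + max d₀ (Finset.univ.sup dg)).choose n) (m : ℕ) :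
    ¬ HasBlockPsdLift (truncatedQuadraticModule d₀ g dg) K m := by
  classical
  set X : Set (Fin n → ℝ) := {x | ∀ i, 0 ≤ eval x (g i)} with hXdef
  set D := max (2 * d₀) (Finset.univ.sup fun i => (g i).totalDegree + 2 * dg i) with hD
  have hcone : ∀ p ∈ truncatedQuadraticModule d₀ g dg, ∀ r : ℝ, 0 < r → r • p ∈ truncatedQuadraticModule d₀ g dg :=
    fun p hp r hr => smul_mem_truncatedQuadraticModule hp hr.le
  have hCX := truncatedQuadraticModule_subset_nonnegPolynomialCone d₀ g dg
  rcases le_or_gt (Finset.univ.sup dg) d₀ with hle | hlt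
  · -- `d = d₀`: the squares `q²`, `q ∈ ℝ[x]_{d₀}`, lie in `Σ_{n,2d₀} ⊆ C`
    rw [max_eq_left hle] at hK
    refine not_hasBlockPsdLift_of_mul_sq_mem (d := d₀) hX hcone hCX 1 (fun x _ => by rw [map_one]; exact one_pos)
      (fun q hq => ?_) (by rwa [card_Idx])
    rw [one_mul]
    exact mem_truncatedQuadraticModule_iff.2 ⟨q ^ 2, sq_mem_sosPolynomialCone q hq, fun _ => 0,
      fun i => zero_mem_sosPolynomialCone n (dg i), by simp⟩
  · -- `d = d_{i₀} > d₀`: use `g_{i₀} q²` and the points of `X` where `g_{i₀} > 0`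
    have hk0 : (Finset.univ : Finset (Fin k)).Nonempty := by
      by_contra h
      rw [Finset.not_nonempty_iff_eq_empty] at h
      rw [h, Finset.sup_empty] at hlt
      exact Nat.not_lt_zero _ hlt
    obtain ⟨i₀, -, hi₀⟩ := Finset.exists_mem_eq_sup _ hk0 dg
    rw [max_eq_right hlt.le, hi₀] at hK
    set X' : Set (Fin n → ℝ) := X ∩ {x | eval x (g i₀) ≠ 0} with hX'
    have hX'int : (interior X').Nonempty := interior_inter_eval_ne_zero_nonempty hX (hg i₀)
    have hCX' : truncatedQuadraticModule d₀ g dg ⊆ nonnegPolynomialCone n D X' := fun p hp =>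
      ⟨(hCX hp).1, fun x hx => (hCX hp).2 x hx.1⟩
    refine not_hasBlockPsdLift_of_mul_sq_mem (d := dg i₀) hX'int hcone hCX' (g i₀)
      (fun x hx => lt_of_le_of_ne (hx.1 i₀) (Ne.symm hx.2)) (fun q hq => ?_) (by rwa [card_Idx])
    refine mem_truncatedQuadraticModule_iff.2 ⟨0, zero_mem_sosPolynomialCone n d₀,
      fun i => if i = i₀ then q ^ 2 else 0, fun i => ?_, ?_⟩
    · dsimp only
      split_ifs with hi
      · subst hi; exact sq_mem_sosPolynomialCone q hq
      · exact zero_mem_sosPolynomialCone n (dg i)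
    · dsimp only
      rw [zero_add, Finset.sum_eq_single i₀]
      · rw [if_pos rfl]
      · intro i _ hi; rw [if_neg hi, mul_zero]
      · intro h; exact absurd (mem_univ i₀) h

/-- **Averkov 2019, Corollary 5: `sxd(Σ_{n,2d₀} + g_1 Σ_{n,2d_1} + ⋯ + g_k Σ_{n,2d_k}) = binom(n+d, n)`,
`d = max{d₀, …, d_k}`**, for `g_1, …, g_k ∈ ℝ[x] ∖ {0}` such that `X = {x : g_1(x) ≥ 0, …, g_k(x) ≥ 0}` has
non-empty interior: "the straightforward extended formulation is optimal in terms of the size of the LMIs when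
`X` has non-empty interior" — the cost of a level of the SOS hierarchy. [cite: Averkov2019, Cor. 5 (p05), proof §5 (p13)] -/
theorem isLeast_blockSize_hasBlockPsdLift_truncatedQuadraticModule {n k : ℕ} (d₀ : ℕ)
    {g : Fin k → MvPolynomial (Fin n) ℝ} (hg : ∀ i, g i ≠ 0)
    (hX : (interior {x : Fin n → ℝ | ∀ i, 0 ≤ eval x (g i)}).Nonempty) (dg : Fin k → ℕ) :
    IsLeast {K : ℕ | ∃ m : ℕ, HasBlockPsdLift (truncatedQuadraticModule d₀ g dg) K m}
      ((n + max d₀ (Finset.univ.sup dg)).choose n) := by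
  refine ⟨⟨1 + k, hasBlockPsdLift_truncatedQuadraticModule d₀ g dg⟩, fun K hK => ?_⟩
  obtain ⟨m, hm⟩ := hK
  by_contra hlt
  exact not_hasBlockPsdLift_truncatedQuadraticModule d₀ hg hX dg (not_le.1 hlt) m hm

/-- **`sxc(Σ_{n,2d}) ≥ binom(n+d,n)`**: no single LMI of size `k < binom(n+d,n)` lifts `Σ_{n,2d}` (the tree's
`HasPsdLift`). [cite: Averkov2019, Cor. 4 (p05), (1.3) (p03)] -/
theorem not_hasPsdLift_sosPolynomialCone {n d k : ℕ} (hk : k < (n + d).choose n) :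
    ¬ HasPsdLift (sosPolynomialCone n d) k := fun h =>
  not_hasBlockPsdLift_sosPolynomialCone hk 1 (hasBlockPsdLift_one_iff.2 h)

/-- `Σ_{n,2d}` is closed under addition (a convex cone). [cite: Averkov2019, §1.2 (p03)] -/
theorem add_mem_sosPolynomialCone {n d : ℕ} {p q : MvPolynomial (Fin n) ℝ} (hp : p ∈ sosPolynomialCone n d)
    (hq : q ∈ sosPolynomialCone n d) : p + q ∈ sosPolynomialCone n d := by
  obtain ⟨hpd, r, f, rfl⟩ := hp
  obtain ⟨hqd, r', g, rfl⟩ := hq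
  refine ⟨(totalDegree_add _ _).trans (max_le hpd hqd), r + r', Fin.append f g, ?_⟩
  rw [Fin.sum_univ_add]
  simp only [Fin.append_left, Fin.append_right]

/-! ### Corollary 14: moment cones -/

namespace SosCone

/-- Evaluation of the monomial `x^β` is the `β`-th entry of the moment vector. [cite: Averkov2019, Remark 23 (p10)] -/
theorem eval_mono {n d : ℕ} (x : Fin n → ℝ) (β : Idx n d) : eval x (mono β) = momentVector d x β := by
  rw [mono, eval_monomial, Finsupp.prod_fintype _ _ (fun _ => pow_zero _), one_mul]
  simp [momentVector]

/-- The zero exponent vector (the monomial `1`). [folklore] -/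
def zeroIdx (n D : ℕ) : Idx n D := ⟨fun _ => 0, by simp⟩

/-- `v(x)_0 = 1`. [cite: Averkov2019, Remark 30 (p12, "appending a component 1")] -/
@[simp] theorem momentVector_zeroIdx {n D : ℕ} (x : Fin n → ℝ) : momentVector D x (zeroIdx n D) = 1 := by
  simp [momentVector, zeroIdx]

/-- The unit exponent vector `e_i` (the monomial `x_i`), for `D ≥ 1`. [folklore] -/
def unitIdx {n D : ℕ} (hD : 1 ≤ D) (i : Fin n) : Idx n D :=
  ⟨fun j => if j = i then ⟨1, by omega⟩ else 0, by
    rw [Finset.sum_eq_single i]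
    · simp [hD]
    · intro j _ hj; simp [hj]
    · simp⟩

/-- `v(x)_{e_i} = x_i`. [cite: Averkov2019, Remark 30 (p12)] -/
@[simp] theorem momentVector_unitIdx {n D : ℕ} (hD : 1 ≤ D) (i : Fin n) (x : Fin n → ℝ) :
    momentVector D x (unitIdx hD i) = x i := by
  classical
  simp only [momentVector, unitIdx]
  rw [Finset.prod_eq_single i]
  · simp
  · intro j _ hj; simp [hj]
  · simp

/-- Splitting a budget: `γ` with `Σ γ ≤ a + b` is `α + β` with `Σ α ≤ a`, `Σ β ≤ b`. [folklore] -/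
private theorem exists_split : ∀ (n : ℕ) (γ : Fin n → ℕ) (a b : ℕ), ∑ i, γ i ≤ a + b →
    ∃ α β : Fin n → ℕ, (∀ i, α i + β i = γ i) ∧ ∑ i, α i ≤ a ∧ ∑ i, β i ≤ b
  | 0, γ, a, b, _ => ⟨fun _ => 0, fun _ => 0, fun i => i.elim0, by simp, by simp⟩
  | n + 1, γ, a, b, h => by
    rw [Fin.sum_univ_succ] at h
    obtain ⟨α', β', hαβ, hα, hβ⟩ := exists_split n (fun i => γ i.succ) (a - min (γ 0) a)
      (b - (γ 0 - min (γ 0) a)) (by omega)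
    refine ⟨Fin.cons (min (γ 0) a) α', Fin.cons (γ 0 - min (γ 0) a) β', fun i => ?_, ?_, ?_⟩
    · refine Fin.cases ?_ (fun j => ?_) i
      · simp only [Fin.cons_zero]; omega
      · simp only [Fin.cons_succ]; exact hαβ j
    · rw [Fin.sum_univ_succ]; simp only [Fin.cons_zero, Fin.cons_succ]; omega
    · rw [Fin.sum_univ_succ]; simp only [Fin.cons_zero, Fin.cons_succ]; omega

/-- Every exponent vector of degree `≤ 2d` is a sum of two of degree `≤ d` (so every monomial of
`v_{n,2d}` is a product of two monomials of `v_{n,d}`, cf. (1.1)). [cite: Averkov2019, (1.1) (p03)] -/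
theorem Idx.exists_add_eq {n d : ℕ} (γ : Idx n (2 * d)) :
    ∃ α β : Idx n d, ∀ i, (α.1 i : ℕ) + (β.1 i : ℕ) = (γ.1 i : ℕ) := by
  obtain ⟨α, β, hαβ, hα, hβ⟩ := exists_split n (fun i => (γ.1 i : ℕ)) d d (by have := γ.2; omega)
  have hαi : ∀ i, α i ≤ d := fun i =>
    le_trans (single_le_sum (f := α) (fun j _ => Nat.zero_le _) (mem_univ i)) hα
  have hβi : ∀ i, β i ≤ d := fun i =>
    le_trans (single_le_sum (f := β) (fun j _ => Nat.zero_le _) (mem_univ i)) hβ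
  refine ⟨⟨fun i => ⟨α i, Nat.lt_succ_of_le (hαi i)⟩, by simpa using hα⟩,
    ⟨fun i => ⟨β i, Nat.lt_succ_of_le (hβi i)⟩, by simpa using hβ⟩, fun i => ?_⟩
  simpa using hαβ i

/-- `x^{α+β} = x^α x^β` on moment vectors. [folklore] -/
private theorem momentVector_eq_mul {n d : ℕ} {x : Fin n → ℝ} {γ : Idx n (2 * d)} {α β : Idx n d}
    (h : ∀ i, (α.1 i : ℕ) + (β.1 i : ℕ) = (γ.1 i : ℕ)) :
    momentVector (2 * d) x γ = momentVector d x α * momentVector d x β := by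
  simp only [momentVector, ← Finset.prod_mul_distrib, ← pow_add, h]

/-- The polynomial `q = Σ_{|α| ≤ d} (x^α)² ∈ Σ_{n,2d}`, whose coefficient vector cuts a bounded base out of
the moment cone (a strictly positive functional on `M_{n,2d}`). [cite: Averkov2019, §3.2 (p08, pointed
cones and bounded affine slices)] -/
def sqNormPoly (n d : ℕ) : MvPolynomial (Fin n) ℝ := ∑ α : Idx n d, mono α ^ 2

/-- `deg q ≤ 2d`. [cite: Averkov2019, §3.2 (p08)] -/
theorem totalDegree_sqNormPoly_le (n d : ℕ) : (sqNormPoly n d).totalDegree ≤ 2 * d :=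
  totalDegree_finsetSum_le fun α _ => (totalDegree_pow _ _).trans
    (Nat.mul_le_mul_left 2 ((totalDegree_monomial_le _ _).trans (Idx.sum_toFinsupp_le α)))

/-- `q(x) = Σ_α (x^α)²`. [cite: Averkov2019, §3.2 (p08)] -/
theorem eval_sqNormPoly {n d : ℕ} (x : Fin n → ℝ) :
    eval x (sqNormPoly n d) = ∑ α : Idx n d, momentVector d x α ^ 2 := by
  simp only [sqNormPoly, map_sum, map_pow, eval_mono]

/-- `q(x) ≥ 1 > 0` (the term `α = 0`). [cite: Averkov2019, §3.2 (p08)] -/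
theorem one_le_eval_sqNormPoly {n d : ℕ} (x : Fin n → ℝ) : 1 ≤ eval x (sqNormPoly n d) := by
  rw [eval_sqNormPoly]
  have h := single_le_sum (f := fun α : Idx n d => momentVector d x α ^ 2) (fun α _ => sq_nonneg _)
    (mem_univ (zeroIdx n d))
  simpa using h

/-- **Every monomial of degree `≤ 2d` is dominated by `q`**: `|x^γ| ≤ q(x)` (`x^γ = x^α x^β` and
`|ab| ≤ (a² + b²)/2`). [cite: Averkov2019, §3.2 (p08)] -/
theorem abs_momentVector_le_eval_sqNormPoly {n d : ℕ} (x : Fin n → ℝ) (γ : Idx n (2 * d)) :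
    |momentVector (2 * d) x γ| ≤ eval x (sqNormPoly n d) := by
  obtain ⟨α, β, hαβ⟩ := Idx.exists_add_eq γ
  rw [momentVector_eq_mul hαβ, eval_sqNormPoly, abs_mul]
  have ha := single_le_sum (f := fun α : Idx n d => momentVector d x α ^ 2) (fun α _ => sq_nonneg _)
    (mem_univ α)
  have hb := single_le_sum (f := fun α : Idx n d => momentVector d x α ^ 2) (fun α _ => sq_nonneg _)
    (mem_univ β)
  set a := momentVector d x α
  set b := momentVector d x β
  have key : |a| * |b| ≤ max (a ^ 2) (b ^ 2) := by
    rcases le_total |a| |b| with h | h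
    · calc |a| * |b| ≤ |b| * |b| := mul_le_mul_of_nonneg_right h (abs_nonneg _)
        _ = b ^ 2 := by rw [← sq, sq_abs]
        _ ≤ _ := le_max_right _ _
    · calc |a| * |b| ≤ |a| * |a| := mul_le_mul_of_nonneg_left h (abs_nonneg _)
        _ = a ^ 2 := by rw [← sq, sq_abs]
        _ ≤ _ := le_max_left _ _
  exact key.trans (max_le ha hb)

end SosCone

/-- **The moment cone `M_{n,D}(X) = cl(cone{v_{n,D}(x) : x ∈ X})`** (closure of the convex conic hull of the
moment vectors of the points of `X`; `M_{n,2d} = M_{n,2d}(ℝⁿ)`), in the coordinates `ℝ^{binom(n+D,n)}` of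
Remark 23. [cite: Averkov2019, §2.1 (p06, `M_{n,2d}`, `M_{n,2d}(X)`)] -/
def momentCone (n D : ℕ) (X : Set (Fin n → ℝ)) : Set (Idx n D → ℝ) :=
  closure (PointedCone.hull ℝ (momentVector D '' X) : Set (Idx n D → ℝ))

/-- The moment vectors of the points of `X` lie in `M_{n,D}(X)`. [cite: Averkov2019, §2.1 (p06)] -/
theorem momentVector_mem_momentCone {n D : ℕ} {X : Set (Fin n → ℝ)} {x : Fin n → ℝ} (hx : x ∈ X) :
    momentVector D x ∈ momentCone n D X :=
  subset_closure (PointedCone.subset_hull ⟨x, hx, rfl⟩)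

/-- `M_{n,D}(X)` is closed under nonnegative scaling. [cite: Averkov2019, §2.1 (p06)] -/
theorem smul_mem_momentCone {n D : ℕ} {X : Set (Fin n → ℝ)} {y : Idx n D → ℝ} (hy : y ∈ momentCone n D X)
    {c : ℝ} (hc : 0 ≤ c) : c • y ∈ momentCone n D X := by
  refine map_mem_closure (continuous_const_smul c) hy fun z hz => ?_
  exact PointedCone.smul_mem _ hc hz

/-- A property of vectors closed under the cone operations and limits holds on `M_{n,D}(X)` once it holds
on the moment vectors. [folklore] -/
private theorem momentCone_induction {n D : ℕ} {X : Set (Fin n → ℝ)} {S : Set (Idx n D → ℝ)}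
    (hS : IsClosed S) (hgen : ∀ x ∈ X, momentVector D x ∈ S) (h0 : (0 : Idx n D → ℝ) ∈ S)
    (hadd : ∀ y ∈ S, ∀ z ∈ S, y + z ∈ S) (hsmul : ∀ (c : ℝ), 0 ≤ c → ∀ y ∈ S, c • y ∈ S) :
    momentCone n D X ⊆ S := by
  refine closure_minimal (fun y hy => ?_) hS
  refine Submodule.span_induction (p := fun y _ => y ∈ S) ?_ h0 (fun y z _ _ hy hz => hadd y hy z hz)
    (fun c y _ hy => ?_) hy
  · rintro _ ⟨x, hx, rfl⟩; exact hgen x hx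
  · exact hsmul c c.2 y hy

/-- **Lemma 32 (one inclusion): `P_{n,D}(X) ⊆ M_{n,D}(X)^*`** — for `f ∈ P_{n,D}(X)` the functional
`y ↦ ⟨y, f⟩` is nonnegative on the moment cone (`⟨v(x), f⟩ = f(x) ≥ 0` on the generators).
[cite: Averkov2019, Lemma 32 (p13)] -/
theorem dotProduct_coeffVec_nonneg_of_mem_momentCone {n D : ℕ} {X : Set (Fin n → ℝ)}
    {f : MvPolynomial (Fin n) ℝ} (hf : f ∈ nonnegPolynomialCone n D X) {y : Idx n D → ℝ}
    (hy : y ∈ momentCone n D X) : 0 ≤ y ⬝ᵥ coeffVec n D f := by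
  have hcl : IsClosed {y : Idx n D → ℝ | 0 ≤ y ⬝ᵥ coeffVec n D f} :=
    isClosed_le continuous_const (Continuous.dotProduct continuous_id continuous_const)
  refine momentCone_induction hcl (fun x hx => ?_) (by simp) (fun y hy z hz => ?_) (fun c hc y hy => ?_) hy
  · change 0 ≤ momentVector D x ⬝ᵥ coeffVec n D f
    rw [← eval_eq_dotProduct hf.1]
    exact hf.2 x hx
  · change 0 ≤ (y + z) ⬝ᵥ coeffVec n D f
    rw [add_dotProduct]; exact add_nonneg hy hz
  · change 0 ≤ (c • y) ⬝ᵥ coeffVec n D f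
    rw [smul_dotProduct, smul_eq_mul]; exact mul_nonneg hc hy

/-- **The coordinates of `M_{n,2d}(X)` are dominated by the functional `⟨·, q⟩`**: `|y_γ| ≤ ⟨y, q⟩` for every
`y ∈ M_{n,2d}(X)` and `|γ| ≤ 2d` — so `{y ∈ M : ⟨y, q⟩ = 1}` is a bounded base and the cone is pointed.
[cite: Averkov2019, §3.2 (p08, "`M`… `P_{n,2d}(X)` … are known to be pointed")] -/
theorem abs_apply_le_of_mem_momentCone {n d : ℕ} {X : Set (Fin n → ℝ)} {y : Idx n (2 * d) → ℝ}
    (hy : y ∈ momentCone n (2 * d) X) (γ : Idx n (2 * d)) :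
    |y γ| ≤ y ⬝ᵥ coeffVec n (2 * d) (sqNormPoly n d) := by
  have hcl : IsClosed {y : Idx n (2 * d) → ℝ | |y γ| ≤ y ⬝ᵥ coeffVec n (2 * d) (sqNormPoly n d)} :=
    isClosed_le (continuous_abs.comp (continuous_apply γ))
      (Continuous.dotProduct continuous_id continuous_const)
  refine momentCone_induction hcl (fun x _ => ?_) (by simp) (fun y hy z hz => ?_) (fun c hc y hy => ?_) hy
  · change |momentVector (2 * d) x γ| ≤ momentVector (2 * d) x ⬝ᵥ coeffVec n (2 * d) (sqNormPoly n d)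
    rw [← eval_eq_dotProduct (totalDegree_sqNormPoly_le n d)]
    exact abs_momentVector_le_eval_sqNormPoly x γ
  · change |(y + z) γ| ≤ (y + z) ⬝ᵥ _
    rw [Pi.add_apply, add_dotProduct]
    exact (abs_add_le _ _).trans (add_le_add hy hz)
  · change |(c • y) γ| ≤ (c • y) ⬝ᵥ _
    rw [Pi.smul_apply, smul_dotProduct, smul_eq_mul, smul_eq_mul, abs_mul, abs_of_nonneg hc]
    exact mul_le_mul_of_nonneg_left hy hc

/-- **Averkov 2019, Corollary 14: `sxd(M_{n,2d}(X)) ≥ binom(n+d, n)` for every `X ⊆ ℝⁿ` with non-empty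
interior** — the moment cone has no `(S^k_+)^m`-lift for `k < binom(n+d,n)`. Averkov derives it from Cor. 3 by
the duality `sxd(C^*) = sxd(C)` (2.2) and `P_{n,2d}(X)^* = M_{n,2d}(X)` (Lemma 32); here the SAME zero pattern
is run directly on the moment side: on the bounded base `{y ∈ M : ⟨y, q⟩ = 1}` (`q = Σ_{|α|≤d} x^{2α}`,
`abs_apply_le_of_mem_momentCone`) the normalized moment vectors `v(x_s)/q(x_s)` of Kronecker points `x_s ∈ X`
form arbitrarily large point sets with respect to which the base is `(binom(n+d,n)−1)`-neighborly — the
valid inequalities `⟨·, p_T²⟩ ≥ 0` (Lemma 32, `p_T ∈ ℝ[x]_d` vanishing exactly on `T`, Lemmas 27–28) — so the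
tree's `not_hasBlockPsdLift_of_isNeighborlyWrt` (Key Lemma 26) applies.
[cite: Averkov2019, Cor. 14 (p06), proof §5 (p13) with Lemma 32] -/
theorem not_hasBlockPsdLift_momentCone {n d k : ℕ} {X : Set (Fin n → ℝ)} (hX : (interior X).Nonempty)
    (hk : k < (n + d).choose n) (m : ℕ) : ¬ HasBlockPsdLift (momentCone n (2 * d) X) k m := by
  classical
  intro hlift
  rw [← card_Idx] at hk
  set N := Fintype.card (Idx n d) with hN
  have hlift' : HasBlockPsdLift (momentCone n (2 * d) X) (N - 1) m := hlift.mono_size (by omega)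
  obtain ⟨x₀, hx₀⟩ := hX
  rcases Nat.lt_or_ge 1 N with hN1 | hN1
  swap
  · -- `N - 1 = 0`: the cone contains `v(x₀) ≠ 0`
    have h := hlift'.subset_zero_of_eq_zero (Or.inl (by omega))
      (momentVector_mem_momentCone (D := 2 * d) (interior_subset hx₀))
    have := congrFun (Set.mem_singleton_iff.1 h) (zeroIdx n (2 * d))
    simp at this
  -- `N ≥ 2`, hence `n ≥ 1` and `d ≥ 1`
  have hn : 0 < n := by
    by_contra hn0
    obtain rfl : n = 0 := by omega
    have hsub : Subsingleton (Idx 0 d) := ⟨fun β γ => Subtype.ext (funext fun i => i.elim0)⟩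
    have := Fintype.card_le_one_iff_subsingleton.2 hsub
    omega
  have hd : 1 ≤ d := by
    by_contra hd0
    obtain rfl : d = 0 := by omega
    have hsub : Subsingleton (Idx n 0) :=
      ⟨fun β γ => Subtype.ext (funext fun i => Fin.ext (by have := (β.1 i).2; have := (γ.1 i).2; omega))⟩
    have := Fintype.card_le_one_iff_subsingleton.2 hsub
    omega
  have h2d : 1 ≤ 2 * d := by omega
  -- Kronecker points in `X`
  obtain ⟨w, t, hw, ht0, ht, hmem⟩ := exists_kronPt_mem ⟨x₀, hx₀⟩ (d + 1)
  let pt : ℕ → (Fin n → ℝ) := fun j => kronPt w (d + 1) (t j)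
  -- the bounded base `B = M ∩ {⟨y, q⟩ = 1}`
  set u : Idx n (2 * d) → ℝ := coeffVec n (2 * d) (sqNormPoly n d) with hu
  let φ : (Idx n (2 * d) → ℝ) →ₗ[ℝ] ℝ :=
    { toFun := fun y => y ⬝ᵥ u
      map_add' := fun y z => add_dotProduct _ _ _
      map_smul' := fun c y => by rw [smul_dotProduct, RingHom.id_apply] }
  have hφ : ∀ y, φ y = y ⬝ᵥ u := fun y => rfl
  set Lev := levelAffineSubspace φ 1 with hLev
  have hmemLev : ∀ y, y ∈ (Lev : Set (Idx n (2 * d) → ℝ)) ↔ y ⬝ᵥ u = 1 := fun y => Iff.rfl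
  set B := momentCone n (2 * d) X ∩ (Lev : Set (Idx n (2 * d) → ℝ)) with hB
  have hsec : HasBlockPsdLift B (N - 1) m := hlift'.inter_affineSubspace Lev
  have hbdd : Bornology.IsBounded B := by
    rw [isBounded_iff_forall_norm_le]
    refine ⟨1, fun y hy => (pi_norm_le_iff_of_nonneg zero_le_one).2 fun γ => ?_⟩
    rw [Real.norm_eq_abs]
    exact (abs_apply_le_of_mem_momentCone hy.1 γ).trans (le_of_eq ((hmemLev y).1 hy.2))
  refine not_hasBlockPsdLift_of_isNeighborlyWrt hbdd (fun M => ?_) hsec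
  -- the normalized moment vectors `v(x_s)/q(x_s)`
  let qv : ℕ → ℝ := fun s => eval (pt s) (sqNormPoly n d)
  have hq : ∀ s, 0 < qv s := fun s => lt_of_lt_of_le one_pos (one_le_eval_sqNormPoly _)
  have hvu : ∀ s, momentVector (2 * d) (pt s) ⬝ᵥ u = qv s := fun s =>
    (eval_eq_dotProduct (totalDegree_sqNormPoly_le n d) _).symm
  let wv : ℕ → (Idx n (2 * d) → ℝ) := fun s => (qv s)⁻¹ • momentVector (2 * d) (pt s)
  have hwB : ∀ s, wv s ∈ B := fun s =>
    ⟨smul_mem_momentCone (momentVector_mem_momentCone (hmem s)) (inv_pos.2 (hq s)).le, by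
      rw [hmemLev, smul_dotProduct, hvu, smul_eq_mul, inv_mul_cancel₀ (hq s).ne']⟩
  have hw_inj : Function.Injective wv := by
    intro s s' h
    have h0 := congrFun h (zeroIdx n (2 * d))
    simp only [wv, Pi.smul_apply, momentVector_zeroIdx, smul_eq_mul, mul_one] at h0
    have h1 := congrFun h (unitIdx h2d ⟨0, hn⟩)
    simp only [wv, Pi.smul_apply, momentVector_unitIdx, smul_eq_mul, h0] at h1
    have h2 := mul_left_cancel₀ (inv_ne_zero (hq s').ne') h1
    simp only [pt, kronPt, pow_zero, pow_one] at h2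
    exact ht (mul_left_cancel₀ (hw _) h2)
  refine ⟨(Finset.range M).image wv, by rw [card_image_of_injective _ hw_inj, card_range], ?_, ?_⟩
  · intro y hy
    obtain ⟨s, -, rfl⟩ := mem_image.1 (mem_coe.1 hy)
    exact hwB s
  -- neighborliness: every `(N-1)`-subset is cut out by `⟨·, p_T²⟩ ≥ 0`
  intro I hI hIk
  let T : Finset ℕ := (Finset.range M).filter fun s => wv s ∈ I
  have hTI : T.image wv = I := by
    ext y
    simp only [T, mem_image, mem_filter, mem_range]
    constructor
    · rintro ⟨s, ⟨-, hs⟩, rfl⟩; exact hs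
    · intro hyI
      obtain ⟨s, hs, rfl⟩ := mem_image.1 (hI hyI)
      exact ⟨s, ⟨mem_range.1 hs, hyI⟩, rfl⟩
  have hTk : T.card = N - 1 := by rw [← card_image_of_injective T hw_inj, hTI, hIk]
  have hpt : Function.Injective pt := by
    intro j j' h
    have h0 := congrFun h ⟨0, hn⟩
    simp only [pt, kronPt, pow_zero, pow_one] at h0
    exact ht (mul_left_cancel₀ (hw _) h0)
  obtain ⟨p, hp0, hpd, hpT⟩ := exists_ne_zero_eval_eq_zero (d := d) (T.image pt)
    (by rw [card_image_of_injective T hpt, hTk]; omega)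
  have hp2 : p ^ 2 ∈ nonnegPolynomialCone n (2 * d) X :=
    ⟨(totalDegree_pow p 2).trans (by omega), fun x _ => by rw [map_pow]; exact sq_nonneg _⟩
  -- `p(x_s) = 0 ⇔ s ∈ T` for `s < M` (unisolvence, Lemma 27)
  have hzero : ∀ s, s < M → (eval (pt s) p = 0 ↔ s ∈ T) := by
    intro s hsM
    constructor
    · intro h0
      by_contra hsT
      apply hp0
      have hc : coeffVec n d p = 0 := by
        refine eq_zero_of_dotProduct_kronPt_eq_zero (Nat.lt_succ_self d) hw ht0 ht (insert s T) ?_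
          fun j hj => ?_
        · rw [card_insert_of_notMem hsT, hTk]; omega
        · rw [← eval_eq_dotProduct hpd]
          rcases mem_insert.1 hj with rfl | hjT
          · exact h0
          · exact hpT _ (mem_image_of_mem pt hjT)
      rw [← ofVec_coeffVec hpd, hc, map_zero]
    · intro hsT
      exact hpT _ (mem_image_of_mem pt hsT)
  refine ⟨-coeffVec n (2 * d) (p ^ 2), 0, fun y hy => ?_, fun y hy => ?_⟩
  · rw [neg_dotProduct, neg_nonpos, dotProduct_comm]
    exact dotProduct_coeffVec_nonneg_of_mem_momentCone hp2 hy.1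
  · obtain ⟨s, hs, rfl⟩ := mem_image.1 hy
    have hsM := mem_range.1 hs
    rw [neg_dotProduct, neg_eq_zero, dotProduct_comm]
    simp only [wv, smul_dotProduct, smul_eq_mul, mul_eq_zero, inv_eq_zero, (hq s).ne', false_or]
    rw [← eval_eq_dotProduct hp2.1, map_pow, pow_eq_zero_iff two_ne_zero, hzero s hsM]
    simp only [T, mem_filter, mem_range, hsM, true_and]
    exact Iff.rfl

/-- **`sxd(M_{n,2d}(X)) ≥ binom(n+d,n)`** as a lower bound on the admissible block sizes.
[cite: Averkov2019, Cor. 14 (p06)] -/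
theorem mem_lowerBounds_blockSize_hasBlockPsdLift_momentCone {n d : ℕ} {X : Set (Fin n → ℝ)}
    (hX : (interior X).Nonempty) :
    (n + d).choose n ∈ lowerBounds {k : ℕ | ∃ m : ℕ, HasBlockPsdLift (momentCone n (2 * d) X) k m} := by
  rintro k ⟨m, hm⟩
  by_contra hlt
  exact not_hasBlockPsdLift_momentCone hX (not_le.1 hlt) m hm

end Literature.Combinatorics.Optimization

end
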